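import Mathlib.Analysis.SpecialFunctions.SmoothTransition
import Mathlib.MeasureTheory.Integral.DominatedConvergence
import Literature.Analysis.FluidPDE.BeltramiFlows
import Literature.Analysis.FluidPDE.WholeSpaceIBP
import Literature.Analysis.FluidPDE.SereginSverakTangentialEnergy
import Literature.Analysis.FluidPDE.SphereIntegral
import Literature.Analysis.FunctionSpaces.SobolevProductLawFourier
import HarnessLib

/-!
# The Liouville theorem for Beltrami flows (Chae–Wolf 2016; Nadirashvili 2014; Chae–Constantin 2015)

Literature file (topic `Analysis/FluidPDE`). Source, HELD and read for this file: D. Chae, J. Wolf,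
*On the Liouville theorem for weak Beltrami flows*, Nonlinearity **29** (2016) 3417–3425 =
arXiv:1506.04361 [`ChaeWolf2016`]; it recovers N. Nadirashvili, GAFA **24** (2014) 916–921
[`Nadirashvili2014`] and D. Chae, P. Constantin, IMRN 2015 (20) 10012–10016 [`ChaeConstantin2014`].

## What is printed

A *Beltrami field* is `u : ℝ³ → ℝ³` with `curl u = λ u` for a scalar function `λ`; a Beltrami field
solving the stationary Euler equations is a *Beltrami flow*, and then `p = -½|u|²` up to a constant
(p. 1). Def. 1.1–1.2: a *weak Beltrami flow* is `u ∈ L²_loc` with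
`∫ u ⊗ u : ∇φ = -∫ p ∇·φ` for all `φ ∈ C_c^∞`, `p = -½|u|²`. With `u_N := (u · x/|x|) x/|x|`,
`u_T := u × x/|x|` (so `|u|² = |u_N|² + |u_T|²`):

> **Theorem 1.3.** Let `u ∈ L²_loc` be a weak Beltrami flow. Then
> `∫_{B_R} |u_N|²/|x| dx ≤ (1/2R) ∫_{B_R} |u|² dx` for all `0 < R < +∞` (2.12) [equation numbers
> as in arXiv:1506.04361].
> Moreover, if there exists a sequence `R_k → +∞` such that `∫_{∂B_{R_k}} |u_T|² dS → 0` (2.13),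
> then `u ≡ 0`.
> **Remark 1.4.** … let `u ∈ L²_loc` be a weak Beltrami flow satisfying one of
> (i) `|u_T(x)| = o(|x|⁻¹)`; (ii) `u_T ∈ L^q(ℝ³)` for some `q ∈ [2,3]`;
> (iii) `|u_T|²/|x|^μ ∈ L¹(ℝ³)` for some `μ ∈ (-∞,1]`. Then (2.13) holds [hence `u ≡ 0`].
> **Remark 1.5.** If `u` is a non-trivial Beltrami flow such that `|u| ≤ K/|x|` … then
> `∫ |u_T|²/|x| = +∞` and `∫ |u_N|²/|x| < +∞`.

Proof (pp. 5–7): the mean-value formula Lemma 2.1 / (2.8) (test the weak formulation with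
`x |x|^{-α}` cut off radially), which for a Beltrami flow gives `φ(r) := r⁻¹∫_{B_r}|u|² =
∫_{∂B_r}(|u_T|² - |u_N|²) dS ≥ 0` nondecreasing (2.11) and `2∫_{B_R∖B_r}|u_N|²/|x| = φ(R) - φ(r)`.

## What is here (all PROVED; no definitions, no named facts)

The CLASSICAL case — `v ∈ C¹(ℝ³; ℝ³)` divergence free with `(v·∇)v = ∇(½|v|²)` pointwise, which is
what the tree's `IsBeltrami v λ` gives (`IsBeltrami.convect_eq_gradient`, Majda–Bertozzi Prop. 2.10)
— in BULK form (balls and annuli instead of spheres):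

* `ChaeWolf2016.integral_inner_convect_eq` — Def. 1.1–1.2: a classical Beltrami flow is a weak one,
  `∫ ⟪v, (v·∇)Φ⟫ = ½ ∫ |v|² div Φ` for `Φ ∈ C¹_c`;
* `ChaeWolf2016.radial_identity` — the tested identity behind Lemma 2.1 for `Φ = h(x) x`, `h ∈ C¹_c`:
  `∫ (∂_v h)⟪x,v⟫ - ½ (∂_x h)|v|² = ½ ∫ h |v|²`;
* **`ChaeWolf2016.integral_normalSq_div_norm_eq`** — Thm 1.3 (2.12), with EQUALITY for continuous
  flows (`φ(0+) = 0`): `∫_{B_R} ⟪x,v⟫²/|x|³ dx = (2R)⁻¹ ∫_{B_R} |v|² dx`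
  (`⟪x,v⟫²/|x|³ = |v_N|²/|x|`), obtained from `radial_identity` with the profile `1/|x| - 1/R`
  through two dominated-convergence passages (smoothing the kink at `|x| = R` with
  `Real.smoothTransition`, and `1/√(|x|²+ε²) → 1/|x|`);
* `ChaeWolf2016.energyRatio_mono` — (2.11): `r ↦ r⁻¹∫_{B_r}|v|²` is nondecreasing, indeed
  `R⁻¹∫_{B_R}|v|² - r⁻¹∫_{B_r}|v|² = 2∫_{B_R∖B_r}⟪x,v⟫²/|x|³` (the display before (2.12));
* `ChaeWolf2016.integral_ball_le_tangential_annulus` — the bulk form of `φ(R) ≤ ∫_{∂B_R}|u_T|²`: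
  `∫_{B_R}|v|² ≤ ∫_{B_{2R}∖B_R} (|v|² - ⟪x,v⟫²/|x|²) dx` (`|v|² - ⟪x,v⟫²/|x|² = |v_T|²`);
* **`ChaeWolf2016.eq_zero_of_tangential_annulus`** — Thm 1.3, Liouville part, with hypothesis (2.13)
  rendered on annuli: `R_k⁻¹ ∫_{B_{2R_k}∖B_{R_k}} |v_T|² → 0` along some `R_k → ∞` ⇒ `v ≡ 0`;
* **`ChaeWolf2016.energyRatio_eq_sphereIntegral`** — (2.11) AS PRINTED, with the tree's sphere
  integral (`SphereIntegral.lean`, `∫_{∂B_R} f dS = R²·sphereIntegral volume f R`):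
  `R⁻¹∫_{B_R}|v|² = R²·sphereIntegral volume (|v|² - 2⟪x,v⟫²/|x|²) R` (`= ∫_{∂B_R}(|v_T|² - |v_N|²) dS`),
  from (2.12) in polar coordinates by differentiating in `R`; `energyRatio_le_sphereIntegral_tangential`
  (`φ(R) ≤ ∫_{∂B_R}|v_T|² dS`); and **`ChaeWolf2016.eq_zero_of_tangential_spheres`** — Thm 1.3 with the
  PRINTED hypothesis (2.13): `R_k²·sphereIntegral volume |v_T|² R_k → 0` along one sequence
  `R_k → ∞` ⇒ `v ≡ 0` (also `IsBeltrami.eq_zero_of_tangential_spheres`);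
* **Remark 1.4 (i)–(iii)** as printed, classical frame: `ChaeWolf2016.eq_zero_of_tangential_littleO`
  (`|x|²|v_T(x)|² → 0` along `cocompact`), `ChaeWolf2016.eq_zero_of_tangential_Lq`
  (`(|v_T|²)^{q/2} ∈ L¹`, `2 ≤ q ≤ 3`; proved by splitting `|v_T|²` at the level `θR⁻²` on each
  annulus — the exponent `2 - 6/q ≤ 0` is where `q ≤ 3` enters),
  `ChaeWolf2016.eq_zero_of_tangential_weighted` (`|v_T|²/|x|^μ ∈ L¹`, `μ ≤ 1`); and, for the tree's
  predicate `IsBeltrami v λ` (+ `C¹`, `div v = 0`), the theorems usually quoted —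
  **Nadirashvili 2014**: `IsBeltrami.eq_zero_of_norm_mul_norm_tendsto_zero` (`|x| |v(x)| → 0` ⇒
  `v ≡ 0`) and `IsBeltrami.eq_zero_of_integrable_norm_rpow` (`|v|^q ∈ L¹`, `q ∈ [2,3]` ⇒ `v ≡ 0`);
  **Chae–Constantin 2015**: `IsBeltrami.eq_zero_of_integrable_norm_sq_div_rpow`
  (`|v|²/|x|^μ ∈ L¹`, `μ ≤ 1` ⇒ `v ≡ 0`); plus `IsBeltrami.integral_normalSq_div_norm_eq`,
  `IsBeltrami.eq_zero_of_tangential_annulus`, `IsBeltrami.convect_eq_gradient_of_contDiff`;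
* Remark 1.5: `ChaeWolf2016.integral_normalSq_div_norm_le_of_decay` — under `|x|·|v(x)| ≤ K`,
  `∫_{B_R}⟪x,v⟫²/|x|³ ≤ (3/2)|B₁| K² = 2πK²` for every `R`;
* tools (private): `1/|x| ∈ L¹_loc(ℝ³)` (polar coordinates) and the integrability of `|v|²/|x|`,
  `⟪x,v⟫²/|x|³` on balls; `0 ≤ |v_T|² ≤ |v|²` is the tree's `SereginSverak2002.tangential_nonneg` /
  `tangential_le_norm_sq` (`SereginSverakTangentialEnergy`, where the same tangential energy
  `|w_τ|² = |w|² - ⟨x,w⟩²/|x|²` governs the Seregin–Šverák 2002 radial blow-up mechanism).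

Consumers: nsreg-p1 door S20 «ChiralWindowDoor» (ROUND-19, design-only; K2 `HomochiralProfileRigidity`:
chiral Type-I ancient profiles — its nearest printed prior art is this family of Beltrami Liouville
theorems, whose decay threshold `o(|x|⁻¹)` / `L³` sits exactly at the Type-I spatial rate
`|v| ≤ D/|x|` of the door class, nsreg-lit LIT-PACK §R79-pre); steady-Euler Liouville questions of the
ns-typeII cells. `lean search` / `rg` 2026-08-27: the tree has `IsBeltrami` and the strong-Beltrami NS
solutions (`BeltramiFlows`, `StrongBeltramiModeSums`, `GeneralStrongBeltramiFlows`) but no Liouville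
theorem for Beltrami or steady Euler flows on `ℝ³`.

WHAT THIS IS NOT (cell ns-regularity-ideate, seat typer; D-0074): not a statement about Navier–Stokes
regularity; a steady-state Liouville theorem for classical Beltrami flows, `C¹` frame (the printed
`L²_loc` weak frame is NOT covered — see the bullets above).
-/

noncomputable section

open MeasureTheory Set Filter Topology Metric InnerProductSpace
open scoped RealInnerProductSpace ENNReal NNReal

namespace Literature.Analysis.FluidPDE

namespace ChaeWolf2016

variable {v : EuclideanSpace ℝ (Fin 3) → EuclideanSpace ℝ (Fin 3)}

/-! ### Def. 1.1–1.2: a classical Beltrami flow is a weak Beltrami flow -/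

/-- **A classical Beltrami flow is a weak Beltrami flow** (Chae–Wolf Def. 1.1–1.2 with `p = -½|v|²`):
for `v ∈ C¹` divergence free with `(v·∇)v = ∇(½|v|²)` and every compactly supported `C¹` test field
`Φ`, `∫ ⟪v, (v·∇)Φ⟫ = ½ ∫ |v|² div Φ` (i.e. `∫ v ⊗ v : ∇Φ = -∫ p ∇·Φ`).
[cite: ChaeWolf2016, Def. 1.1 and Def. 1.2] -/
theorem integral_inner_convect_eq (hv : ContDiff ℝ 1 v) (hdiv : VectorCalculus.IsDivFree v)
    (hconv : ∀ x, convect v v x = gradient (fun y => ‖v y‖ ^ 2 / 2) x)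
    {Φ : EuclideanSpace ℝ (Fin 3) → EuclideanSpace ℝ (Fin 3)} (hΦ : ContDiff ℝ 1 Φ) (hcΦ : HasCompactSupport Φ) :
    ∫ x, ⟪v x, convect v Φ x⟫ = (1 / 2 : ℝ) * ∫ x, ‖v x‖ ^ 2 * VectorCalculus.divergence Φ x := by
  have h1 := integral_inner_convect_add_eq_zero hv hv hΦ hcΦ
  have hp : ContDiff ℝ 1 fun y => ‖v y‖ ^ 2 / 2 := (hv.norm_sq ℝ).div_const 2
  have h2 := integral_inner_gradient_eq_neg_integral_mul_divergence hp hΦ hcΦ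
  have h3 : ∫ x, VectorCalculus.divergence v x * ⟪v x, Φ x⟫ = 0 := by
    simp [hdiv _]
  have h4 : ∫ x, ⟪convect v v x, Φ x⟫ = ∫ x, ⟪gradient (fun y => ‖v y‖ ^ 2 / 2) x, Φ x⟫ :=
    integral_congr_ae (Eventually.of_forall fun x => congr_arg (fun w => ⟪w, Φ x⟫) (hconv x))
  have h5 : ∫ x, (‖v x‖ ^ 2 / 2) * VectorCalculus.divergence Φ x =
      (1 / 2 : ℝ) * ∫ x, ‖v x‖ ^ 2 * VectorCalculus.divergence Φ x := by
    rw [← integral_const_mul]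
    refine integral_congr_ae (Eventually.of_forall fun x => ?_)
    ring
  linarith

/-! ### Lemma 2.1 in tested form: radial test fields `Φ(x) = h(x) x` -/

/-- `div (x ↦ x) = 3` on `ℝ³`. [folklore] -/
private theorem divergence_id (x : EuclideanSpace ℝ (Fin 3)) : VectorCalculus.divergence (fun y : EuclideanSpace ℝ (Fin 3) => y) x = 3 := by
  have h : (fderiv ℝ (fun y : EuclideanSpace ℝ (Fin 3) => y) x : EuclideanSpace ℝ (Fin 3) →ₗ[ℝ] EuclideanSpace ℝ (Fin 3)) = LinearMap.id := by
    rw [show (fun y : EuclideanSpace ℝ (Fin 3) => y) = id from rfl, fderiv_id]; rfl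
  rw [VectorCalculus.divergence, h, LinearMap.trace_id, finrank_euclideanSpace_fin]
  norm_num

/-- **The radial mean-value identity** (the computation behind Chae–Wolf Lemma 2.1 / (2.5), tested
against `Φ(x) = h(x) x`): for a classical Beltrami flow `v` and `h ∈ C¹_c(ℝ³; ℝ)`,
`∫ (Dh(x)v)⟪x,v⟫ - ½ (Dh(x)x) |v|² dx = ½ ∫ h |v|² dx`
(`⟪v,(v·∇)(h x)⟫ = h|v|² + (Dh v)⟪x,v⟫`, `div (h x) = 3h + Dh x`).
[cite: ChaeWolf2016, Lemma 2.1, proof, display before (2.5)] -/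
theorem radial_identity (hv : ContDiff ℝ 1 v) (hdiv : VectorCalculus.IsDivFree v)
    (hconv : ∀ x, convect v v x = gradient (fun y => ‖v y‖ ^ 2 / 2) x)
    {h : EuclideanSpace ℝ (Fin 3) → ℝ} (hh : ContDiff ℝ 1 h) (hch : HasCompactSupport h) :
    ∫ x, (fderiv ℝ h x (v x) * ⟪x, v x⟫ - (1 / 2 : ℝ) * fderiv ℝ h x x * ‖v x‖ ^ 2) =
      (1 / 2 : ℝ) * ∫ x, h x * ‖v x‖ ^ 2 := by
  -- the test field `Φ = h • id`
  have hΦ : ContDiff ℝ 1 fun x : EuclideanSpace ℝ (Fin 3) => h x • x := hh.smul contDiff_id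
  have hcΦ : HasCompactSupport fun x : EuclideanSpace ℝ (Fin 3) => h x • x := hch.smul_right
  have key := integral_inner_convect_eq hv hdiv hconv hΦ hcΦ
  -- pointwise expansions of the two integrands
  have hL : ∀ x, ⟪v x, convect v (fun y : EuclideanSpace ℝ (Fin 3) => h y • y) x⟫ =
      h x * ‖v x‖ ^ 2 + fderiv ℝ h x (v x) * ⟪x, v x⟫ := fun x => by
    have hd : DifferentiableAt ℝ h x := hh.differentiable one_ne_zero x
    rw [convect_smul_apply (w := fun y : EuclideanSpace ℝ (Fin 3) => y) hd differentiableAt_id]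
    simp only [convect, fderiv_fun_id, ContinuousLinearMap.coe_id', id_eq, inner_add_right,
      real_inner_smul_right, real_inner_self_eq_norm_sq]
    rw [real_inner_comm]
  have hR : ∀ x, VectorCalculus.divergence (fun y : EuclideanSpace ℝ (Fin 3) => h y • y) x =
      3 * h x + fderiv ℝ h x x := fun x => by
    have hd : DifferentiableAt ℝ h x := hh.differentiable one_ne_zero x
    rw [divergence_smul_apply (u := fun y : EuclideanSpace ℝ (Fin 3) => y) hd differentiableAt_id, divergence_id, gradient,
      real_inner_comm, InnerProductSpace.toDual_symm_apply]
    ring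
  simp_rw [hL, hR] at key
  -- integrability of the pieces (continuous, compactly supported)
  have hcont_dh : Continuous fun x => fderiv ℝ h x := hh.continuous_fderiv one_ne_zero
  have hi1 : Integrable (fun x => h x * ‖v x‖ ^ 2) := by
    refine ((hh.continuous.mul (hv.continuous.norm.pow 2)).integrable_of_hasCompactSupport
      (hch.mul_right))
  have hi2 : Integrable (fun x => fderiv ℝ h x (v x) * ⟪x, v x⟫) := by
    refine ((hcont_dh.clm_apply hv.continuous).mul
      (continuous_id.inner hv.continuous)).integrable_of_hasCompactSupport ?_
    exact (hch.fderiv (𝕜 := ℝ)).mono fun x hx => by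
      contrapose! hx; simp only [Function.mem_support, not_not] at hx; simp [hx]
  have hi3 : Integrable (fun x => fderiv ℝ h x x * ‖v x‖ ^ 2) := by
    refine ((hcont_dh.clm_apply continuous_id).mul
      (hv.continuous.norm.pow 2)).integrable_of_hasCompactSupport ?_
    exact (hch.fderiv (𝕜 := ℝ)).mono fun x hx => by
      contrapose! hx; simp only [Function.mem_support, not_not] at hx; simp [hx]
  have e1 : ∫ x, (h x * ‖v x‖ ^ 2 + fderiv ℝ h x (v x) * ⟪x, v x⟫) =
      (∫ x, h x * ‖v x‖ ^ 2) + ∫ x, fderiv ℝ h x (v x) * ⟪x, v x⟫ := integral_add hi1 hi2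
  have e2 : ∫ x, ‖v x‖ ^ 2 * (3 * h x + fderiv ℝ h x x) =
      3 * (∫ x, h x * ‖v x‖ ^ 2) + ∫ x, fderiv ℝ h x x * ‖v x‖ ^ 2 := by
    have : ∀ x, ‖v x‖ ^ 2 * (3 * h x + fderiv ℝ h x x) =
        3 * (h x * ‖v x‖ ^ 2) + fderiv ℝ h x x * ‖v x‖ ^ 2 := fun x => by ring
    simp_rw [this]
    rw [integral_add (hi1.const_mul 3) hi3, integral_const_mul]
  have e3 : ∫ x, (fderiv ℝ h x (v x) * ⟪x, v x⟫ - (1 / 2 : ℝ) * fderiv ℝ h x x * ‖v x‖ ^ 2) =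
      (∫ x, fderiv ℝ h x (v x) * ⟪x, v x⟫) - (1 / 2 : ℝ) * ∫ x, fderiv ℝ h x x * ‖v x‖ ^ 2 := by
    rw [← integral_const_mul, ← integral_sub hi2 (hi3.const_mul _)]
    refine integral_congr_ae (Eventually.of_forall fun x => ?_)
    ring
  rw [e1, e2] at key
  rw [e3]
  linarith


/-! ### The smoothed radial profiles

The profile `1/|x| - 1/R` of the proof of (2.12) is approximated by the `C¹` functions
`H_{ε,n}(|x|²)`, `H_{ε,n}(t) = (ψ_ε(t) - ψ_ε(R²)) · S(n(R² - t))` with `ψ_ε(t) = 1/√(t + ε²)` and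
`S = Real.smoothTransition` (so `S(n(R² - |x|²)) → 1_{B_R}`).  No definitions are introduced: the
profiles are written out in full (`ψ_ε(t) = (√(t+ε²))⁻¹`, `ψ_ε'(t) = -½ (√(t+ε²)³)⁻¹`). -/

/-- `ψ_ε'(t) = -½(√(t+ε²)³)⁻¹` for `t + ε² > 0`. [folklore] -/
private theorem hasDerivAt_psi {ε t : ℝ} (ht : 0 < t + ε ^ 2) :
    HasDerivAt (fun s => (Real.sqrt (s + ε ^ 2))⁻¹)
      (-(1 / 2 : ℝ) * (Real.sqrt (t + ε ^ 2) ^ 3)⁻¹) t := by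
  have hne : Real.sqrt (t + ε ^ 2) ≠ 0 := (Real.sqrt_pos.2 ht).ne'
  have h1 : HasDerivAt (fun s => Real.sqrt (s + ε ^ 2)) (1 / (2 * Real.sqrt (t + ε ^ 2))) t := by
    simpa using ((hasDerivAt_id t).add_const (ε ^ 2)).sqrt ht.ne'
  have hval : -(1 / (2 * Real.sqrt (t + ε ^ 2))) / Real.sqrt (t + ε ^ 2) ^ 2 =
      -(1 / 2 : ℝ) * (Real.sqrt (t + ε ^ 2) ^ 3)⁻¹ := by
    field_simp
  have h2 := h1.inv hne
  rw [hval] at h2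
  exact h2

/-- `ε ≤ √(t + ε²)` for `t ≥ 0`. [folklore] -/
private theorem le_sqrt_add_sq {ε t : ℝ} (hε : 0 < ε) (ht : 0 ≤ t) : ε ≤ Real.sqrt (t + ε ^ 2) := by
  calc ε = Real.sqrt (ε ^ 2) := (Real.sqrt_sq hε.le).symm
    _ ≤ Real.sqrt (t + ε ^ 2) := Real.sqrt_le_sqrt (by linarith)

/-- `ψ_ε(t) ≤ 1/ε` for `t ≥ 0`. [folklore] -/
private theorem psi_le_inv {ε t : ℝ} (hε : 0 < ε) (ht : 0 ≤ t) : (Real.sqrt (t + ε ^ 2))⁻¹ ≤ ε⁻¹ :=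
  inv_anti₀ hε (le_sqrt_add_sq hε ht)

/-- `|ψ_ε'(t)| ≤ 1/(2ε³)` for `t ≥ 0`. [folklore] -/
private theorem abs_dpsi_le {ε t : ℝ} (hε : 0 < ε) (ht : 0 ≤ t) :
    |-(1 / 2 : ℝ) * (Real.sqrt (t + ε ^ 2) ^ 3)⁻¹| ≤ (1 / 2) * (ε ^ 3)⁻¹ := by
  have h3 : ε ^ 3 ≤ Real.sqrt (t + ε ^ 2) ^ 3 := pow_le_pow_left₀ hε.le (le_sqrt_add_sq hε ht) 3
  rw [abs_mul, abs_neg, abs_of_pos (by norm_num : (0 : ℝ) < 1 / 2), abs_of_pos (by positivity)]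
  exact mul_le_mul_of_nonneg_left (inv_anti₀ (by positivity) h3) (by norm_num)

/-- Lipschitz bound `|ψ_ε(t) - ψ_ε(s)| ≤ |t - s|/(2ε³)` for `s, t ≥ 0` (mean value theorem). [folklore] -/
private theorem abs_psi_sub_psi_le {ε s t : ℝ} (hε : 0 < ε) (hs : 0 ≤ s) (ht : 0 ≤ t) :
    |(Real.sqrt (t + ε ^ 2))⁻¹ - (Real.sqrt (s + ε ^ 2))⁻¹| ≤ (1 / 2) * (ε ^ 3)⁻¹ * |t - s| := by
  have hderiv : ∀ u ∈ Ici (0 : ℝ), HasDerivWithinAt (fun s => (Real.sqrt (s + ε ^ 2))⁻¹)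
      (-(1 / 2 : ℝ) * (Real.sqrt (u + ε ^ 2) ^ 3)⁻¹) (Ici 0) u := fun u hu =>
    (hasDerivAt_psi (by have := mem_Ici.1 hu; positivity)).hasDerivWithinAt
  have hbound : ∀ u ∈ Ici (0 : ℝ), ‖-(1 / 2 : ℝ) * (Real.sqrt (u + ε ^ 2) ^ 3)⁻¹‖ ≤
      (1 / 2) * (ε ^ 3)⁻¹ := fun u hu => by
    rw [Real.norm_eq_abs]; exact abs_dpsi_le hε (mem_Ici.1 hu)
  have := (convex_Ici (0 : ℝ)).norm_image_sub_le_of_norm_hasDerivWithin_le hderiv hbound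
    (mem_Ici.2 hs) (mem_Ici.2 ht)
  rw [Real.norm_eq_abs, Real.norm_eq_abs] at this
  exact this

/-! #### `S = Real.smoothTransition`: the derivative vanishes off `[0,1]` and is bounded -/

/-- `S' = 0` on `(-∞, 0)` (`S = 0` there). [folklore] -/
private theorem deriv_smoothTransition_of_neg {t : ℝ} (ht : t < 0) :
    deriv Real.smoothTransition t = 0 := by
  have h : Real.smoothTransition =ᶠ[𝓝 t] fun _ => (0 : ℝ) :=
    (eventually_lt_nhds ht).mono fun s hs => Real.smoothTransition.zero_of_nonpos hs.le
  rw [h.deriv_eq, deriv_const]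

/-- `S' = 0` on `(1, ∞)` (`S = 1` there). [folklore] -/
private theorem deriv_smoothTransition_of_one_lt {t : ℝ} (ht : 1 < t) :
    deriv Real.smoothTransition t = 0 := by
  have h : Real.smoothTransition =ᶠ[𝓝 t] fun _ => (1 : ℝ) :=
    (eventually_gt_nhds ht).mono fun s hs => Real.smoothTransition.one_of_one_le hs.le
  rw [h.deriv_eq, deriv_const]

/-- A bound `M` with `|u · S'(u)| ≤ M` for all `u` (`S'` is continuous and vanishes off `[0,1]`).
[folklore] -/
private theorem exists_bound_mul_deriv_smoothTransition :
    ∃ M : ℝ, 0 ≤ M ∧ ∀ u, |u * deriv Real.smoothTransition u| ≤ M := by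
  have hc : Continuous (deriv Real.smoothTransition) :=
    (Real.smoothTransition.contDiff (n := 1)).continuous_deriv le_rfl
  obtain ⟨M, hM⟩ := isCompact_Icc.exists_bound_of_continuousOn
    (hc.continuousOn (s := Icc (0 : ℝ) 1))
  refine ⟨max M 0, le_max_right _ _, fun u => ?_⟩
  rcases lt_or_ge u 0 with h | h
  · rw [deriv_smoothTransition_of_neg h, mul_zero, abs_zero]; exact le_max_right _ _
  rcases le_or_gt u 1 with h' | h'
  · rw [abs_mul, abs_of_nonneg h]
    calc u * |deriv Real.smoothTransition u| ≤ 1 * max M 0 :=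
          mul_le_mul h' (((Real.norm_eq_abs _).symm.le.trans (hM u ⟨h, h'⟩)).trans (le_max_left _ _))
            (abs_nonneg _) zero_le_one
      _ = max M 0 := one_mul _
  · rw [deriv_smoothTransition_of_one_lt h', mul_zero, abs_zero]; exact le_max_right _ _

/-! #### The profile `H_{ε,n}` and its derivative `A_{ε,n}`

`H(t) = ((√(t+ε²))⁻¹ - (√(R²+ε²))⁻¹) S(n(R²-t))`,
`A(t) = -½(√(t+ε²)³)⁻¹ S(n(R²-t)) - n ((√(t+ε²))⁻¹ - (√(R²+ε²))⁻¹) S'(n(R²-t))`. -/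

/-- `H' = A` on `t + ε² > 0` (product and chain rules). [folklore] -/
private theorem hasDerivAt_prof (ε R : ℝ) (n : ℕ) {t : ℝ} (ht : 0 < t + ε ^ 2) :
    HasDerivAt (fun s => ((Real.sqrt (s + ε ^ 2))⁻¹ - (Real.sqrt (R ^ 2 + ε ^ 2))⁻¹) *
        Real.smoothTransition (n * (R ^ 2 - s)))
      (-(1 / 2 : ℝ) * (Real.sqrt (t + ε ^ 2) ^ 3)⁻¹ * Real.smoothTransition (n * (R ^ 2 - t)) -
        n * ((Real.sqrt (t + ε ^ 2))⁻¹ - (Real.sqrt (R ^ 2 + ε ^ 2))⁻¹) *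
          deriv Real.smoothTransition (n * (R ^ 2 - t))) t := by
  have h1 : HasDerivAt (fun s => (Real.sqrt (s + ε ^ 2))⁻¹ - (Real.sqrt (R ^ 2 + ε ^ 2))⁻¹)
      (-(1 / 2 : ℝ) * (Real.sqrt (t + ε ^ 2) ^ 3)⁻¹) t := (hasDerivAt_psi ht).sub_const _
  have hS : HasDerivAt Real.smoothTransition (deriv Real.smoothTransition (n * (R ^ 2 - t)))
      (n * (R ^ 2 - t)) :=
    (((Real.smoothTransition.contDiff (n := 1)).differentiable one_ne_zero) _).hasDerivAt
  have h2 : HasDerivAt (fun s => (n : ℝ) * (R ^ 2 - s)) (-(n : ℝ)) t := by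
    simpa using ((hasDerivAt_id t).const_sub (R ^ 2)).const_mul (n : ℝ)
  have h3' := hS.comp t h2
  have h3 : HasDerivAt (fun s => Real.smoothTransition ((n : ℝ) * (R ^ 2 - s)))
      (deriv Real.smoothTransition (n * (R ^ 2 - t)) * -(n : ℝ)) t := h3'
  have h4 := h1.mul h3
  have hfun : ((fun s => (Real.sqrt (s + ε ^ 2))⁻¹ - (Real.sqrt (R ^ 2 + ε ^ 2))⁻¹) * fun s =>
      Real.smoothTransition ((n : ℝ) * (R ^ 2 - s))) = fun s =>
        ((Real.sqrt (s + ε ^ 2))⁻¹ - (Real.sqrt (R ^ 2 + ε ^ 2))⁻¹) *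
          Real.smoothTransition (n * (R ^ 2 - s)) := by
    funext s; simp only [Pi.mul_apply]
  rw [hfun] at h4
  refine h4.congr_deriv ?_
  ring

/-- The test function `h(x) = H(|x|²)` is `C¹`. [folklore] -/
private theorem contDiff_test {ε : ℝ} (hε : 0 < ε) (R : ℝ) (n : ℕ) :
    ContDiff ℝ 1 fun y : EuclideanSpace ℝ (Fin 3) => ((Real.sqrt (‖y‖ ^ 2 + ε ^ 2))⁻¹ - (Real.sqrt (R ^ 2 + ε ^ 2))⁻¹) *
        Real.smoothTransition (n * (R ^ 2 - ‖y‖ ^ 2)) := by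
  have h1 : ContDiff ℝ 1 fun y : EuclideanSpace ℝ (Fin 3) => ‖y‖ ^ 2 := contDiff_norm_sq ℝ
  have h2 : ContDiff ℝ 1 fun y : EuclideanSpace ℝ (Fin 3) => (Real.sqrt (‖y‖ ^ 2 + ε ^ 2))⁻¹ := by
    refine ContDiff.inv ((h1.add contDiff_const).sqrt fun y => ?_) fun y => ?_
    · positivity
    · exact (Real.sqrt_pos.2 (by positivity)).ne'
  have h3 : ContDiff ℝ 1 fun y : EuclideanSpace ℝ (Fin 3) => Real.smoothTransition (n * (R ^ 2 - ‖y‖ ^ 2)) :=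
    Real.smoothTransition.contDiff.comp (contDiff_const.mul (contDiff_const.sub h1))
  exact (h2.sub contDiff_const).mul h3

/-- The derivative of the test function: `D[H(|·|²)](x) w = A(|x|²) · 2⟪x, w⟫`. [folklore] -/
private theorem fderiv_test {ε : ℝ} (hε : 0 < ε) (R : ℝ) (n : ℕ) (x w : EuclideanSpace ℝ (Fin 3)) :
    fderiv ℝ (fun y : EuclideanSpace ℝ (Fin 3) => ((Real.sqrt (‖y‖ ^ 2 + ε ^ 2))⁻¹ - (Real.sqrt (R ^ 2 + ε ^ 2))⁻¹) *
        Real.smoothTransition (n * (R ^ 2 - ‖y‖ ^ 2))) x w =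
      (-(1 / 2 : ℝ) * (Real.sqrt (‖x‖ ^ 2 + ε ^ 2) ^ 3)⁻¹ *
          Real.smoothTransition (n * (R ^ 2 - ‖x‖ ^ 2)) -
        n * ((Real.sqrt (‖x‖ ^ 2 + ε ^ 2))⁻¹ - (Real.sqrt (R ^ 2 + ε ^ 2))⁻¹) *
          deriv Real.smoothTransition (n * (R ^ 2 - ‖x‖ ^ 2))) * (2 * ⟪x, w⟫) := by
  have h := (hasDerivAt_prof ε R n (t := ‖x‖ ^ 2) (by positivity)).comp_hasFDerivAt x
    (hasStrictFDerivAt_norm_sq x).hasFDerivAt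
  rw [show (fun y : EuclideanSpace ℝ (Fin 3) => ((Real.sqrt (‖y‖ ^ 2 + ε ^ 2))⁻¹ - (Real.sqrt (R ^ 2 + ε ^ 2))⁻¹) *
        Real.smoothTransition (n * (R ^ 2 - ‖y‖ ^ 2))) =
      (fun s => ((Real.sqrt (s + ε ^ 2))⁻¹ - (Real.sqrt (R ^ 2 + ε ^ 2))⁻¹) *
        Real.smoothTransition (n * (R ^ 2 - s))) ∘ fun y : EuclideanSpace ℝ (Fin 3) => ‖y‖ ^ 2 from rfl, h.fderiv]
  simp [innerSL_apply_apply, smul_eq_mul]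

/-- Off the open ball the cutoff factor vanishes: `S(n(R² - |x|²)) = 0` for `R ≤ |x|`. [folklore] -/
private theorem smoothTransition_cutoff_eq_zero {R : ℝ} (hR : 0 ≤ R) (n : ℕ) {x : EuclideanSpace ℝ (Fin 3)}
    (hx : R ≤ ‖x‖) : Real.smoothTransition (n * (R ^ 2 - ‖x‖ ^ 2)) = 0 := by
  apply Real.smoothTransition.zero_of_nonpos
  have : R ^ 2 ≤ ‖x‖ ^ 2 := pow_le_pow_left₀ hR hx 2
  exact mul_nonpos_of_nonneg_of_nonpos (Nat.cast_nonneg n) (by linarith)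

/-- Off the closed ball the kink term vanishes too, so `A(|x|²) = 0` for `R < |x|`. [folklore] -/
private theorem dprof_eq_zero_of_lt (ε : ℝ) {R : ℝ} (hR : 0 ≤ R) (n : ℕ) {x : EuclideanSpace ℝ (Fin 3)} (hx : R < ‖x‖) :
    -(1 / 2 : ℝ) * (Real.sqrt (‖x‖ ^ 2 + ε ^ 2) ^ 3)⁻¹ *
          Real.smoothTransition (n * (R ^ 2 - ‖x‖ ^ 2)) -
        n * ((Real.sqrt (‖x‖ ^ 2 + ε ^ 2))⁻¹ - (Real.sqrt (R ^ 2 + ε ^ 2))⁻¹) *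
          deriv Real.smoothTransition (n * (R ^ 2 - ‖x‖ ^ 2)) = 0 := by
  rw [smoothTransition_cutoff_eq_zero hR n hx.le, mul_zero, zero_sub, neg_eq_zero]
  rcases Nat.eq_zero_or_pos n with hn | hn
  · simp [hn]
  · have hlt : (n : ℝ) * (R ^ 2 - ‖x‖ ^ 2) < 0 := by
      have : R ^ 2 < ‖x‖ ^ 2 := pow_lt_pow_left₀ hx hR two_ne_zero
      exact mul_neg_of_pos_of_neg (Nat.cast_pos.2 hn) (by linarith)
    rw [deriv_smoothTransition_of_neg hlt, mul_zero]

/-- `H(|x|²) = 0` for `R ≤ |x|`: the test function is supported in the closed ball. [folklore] -/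
private theorem prof_eq_zero_of_le (ε : ℝ) {R : ℝ} (hR : 0 ≤ R) (n : ℕ) {x : EuclideanSpace ℝ (Fin 3)} (hx : R ≤ ‖x‖) :
    ((Real.sqrt (‖x‖ ^ 2 + ε ^ 2))⁻¹ - (Real.sqrt (R ^ 2 + ε ^ 2))⁻¹) *
      Real.smoothTransition (n * (R ^ 2 - ‖x‖ ^ 2)) = 0 := by
  rw [smoothTransition_cutoff_eq_zero hR n hx, mul_zero]

/-- The test function has compact support (inside the closed ball of radius `R`). [folklore] -/
private theorem hasCompactSupport_test (ε : ℝ) {R : ℝ} (hR : 0 ≤ R) (n : ℕ) :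
    HasCompactSupport fun y : EuclideanSpace ℝ (Fin 3) => ((Real.sqrt (‖y‖ ^ 2 + ε ^ 2))⁻¹ -
      (Real.sqrt (R ^ 2 + ε ^ 2))⁻¹) * Real.smoothTransition (n * (R ^ 2 - ‖y‖ ^ 2)) := by
  refine HasCompactSupport.intro (isCompact_closedBall (0 : EuclideanSpace ℝ (Fin 3)) R) fun x hx => ?_
  rw [mem_closedBall, dist_zero_right, not_le] at hx
  exact prof_eq_zero_of_le ε hR n hx.le

/-- Uniform bound on the derivative profile: `|A(t)| ≤ (1 + M)/(2ε³)` for `t ≥ 0`. [folklore] -/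
private theorem abs_dprof_le {ε : ℝ} (hε : 0 < ε) (R : ℝ) {M : ℝ}
    (hM : ∀ u, |u * deriv Real.smoothTransition u| ≤ M) (n : ℕ) {t : ℝ} (ht : 0 ≤ t) :
    |-(1 / 2 : ℝ) * (Real.sqrt (t + ε ^ 2) ^ 3)⁻¹ * Real.smoothTransition (n * (R ^ 2 - t)) -
        n * ((Real.sqrt (t + ε ^ 2))⁻¹ - (Real.sqrt (R ^ 2 + ε ^ 2))⁻¹) *
          deriv Real.smoothTransition (n * (R ^ 2 - t))| ≤ (1 / 2) * (ε ^ 3)⁻¹ * (1 + M) := by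
  have hS01 : |Real.smoothTransition (n * (R ^ 2 - t))| ≤ 1 := by
    rw [abs_of_nonneg (Real.smoothTransition.nonneg _)]; exact Real.smoothTransition.le_one _
  have h1 : |-(1 / 2 : ℝ) * (Real.sqrt (t + ε ^ 2) ^ 3)⁻¹ * Real.smoothTransition (n * (R ^ 2 - t))|
      ≤ (1 / 2) * (ε ^ 3)⁻¹ := by
    rw [abs_mul]
    calc |-(1 / 2 : ℝ) * (Real.sqrt (t + ε ^ 2) ^ 3)⁻¹| * |Real.smoothTransition (n * (R ^ 2 - t))|
        ≤ (1 / 2) * (ε ^ 3)⁻¹ * 1 :=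
          mul_le_mul (abs_dpsi_le hε ht) hS01 (abs_nonneg _) (by positivity)
      _ = _ := mul_one _
  have h2 : |(n : ℝ) * ((Real.sqrt (t + ε ^ 2))⁻¹ - (Real.sqrt (R ^ 2 + ε ^ 2))⁻¹) *
      deriv Real.smoothTransition (n * (R ^ 2 - t))| ≤ (1 / 2) * (ε ^ 3)⁻¹ * M := by
    have hpsi := abs_psi_sub_psi_le (ε := ε) (s := R ^ 2) (t := t) hε (sq_nonneg R) ht
    calc |(n : ℝ) * ((Real.sqrt (t + ε ^ 2))⁻¹ - (Real.sqrt (R ^ 2 + ε ^ 2))⁻¹) *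
          deriv Real.smoothTransition (n * (R ^ 2 - t))|
        = |(Real.sqrt (t + ε ^ 2))⁻¹ - (Real.sqrt (R ^ 2 + ε ^ 2))⁻¹| *
            |(n : ℝ) * deriv Real.smoothTransition (n * (R ^ 2 - t))| := by
          rw [← abs_mul]; ring_nf
      _ ≤ ((1 / 2) * (ε ^ 3)⁻¹ * |t - R ^ 2|) *
            |(n : ℝ) * deriv Real.smoothTransition (n * (R ^ 2 - t))| :=
          mul_le_mul_of_nonneg_right hpsi (abs_nonneg _)
      _ = (1 / 2) * (ε ^ 3)⁻¹ *
            |(n : ℝ) * (R ^ 2 - t) * deriv Real.smoothTransition (n * (R ^ 2 - t))| := by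
          rw [abs_sub_comm, mul_assoc ((1 / 2) * (ε ^ 3)⁻¹), ← abs_mul]
          congr 2
          ring
      _ ≤ (1 / 2) * (ε ^ 3)⁻¹ * M := mul_le_mul_of_nonneg_left (hM _) (by positivity)
  calc _ ≤ |-(1 / 2 : ℝ) * (Real.sqrt (t + ε ^ 2) ^ 3)⁻¹ * Real.smoothTransition (n * (R ^ 2 - t))| +
        |(n : ℝ) * ((Real.sqrt (t + ε ^ 2))⁻¹ - (Real.sqrt (R ^ 2 + ε ^ 2))⁻¹) *
          deriv Real.smoothTransition (n * (R ^ 2 - t))| := abs_sub _ _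
    _ ≤ (1 / 2) * (ε ^ 3)⁻¹ + (1 / 2) * (ε ^ 3)⁻¹ * M := add_le_add h1 h2
    _ = (1 / 2) * (ε ^ 3)⁻¹ * (1 + M) := by ring

/-- Pointwise limit of the derivative profile: `A_n(|x|²) → ψ_ε'(|x|²) · 1_{B_R}(x)` for EVERY `x`. [folklore] -/
private theorem tendsto_dprof (ε : ℝ) {R : ℝ} (hR : 0 ≤ R) (x : EuclideanSpace ℝ (Fin 3)) :
    Tendsto (fun n : ℕ => -(1 / 2 : ℝ) * (Real.sqrt (‖x‖ ^ 2 + ε ^ 2) ^ 3)⁻¹ *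
          Real.smoothTransition (n * (R ^ 2 - ‖x‖ ^ 2)) -
        n * ((Real.sqrt (‖x‖ ^ 2 + ε ^ 2))⁻¹ - (Real.sqrt (R ^ 2 + ε ^ 2))⁻¹) *
          deriv Real.smoothTransition (n * (R ^ 2 - ‖x‖ ^ 2))) atTop
      (𝓝 ((ball (0 : EuclideanSpace ℝ (Fin 3)) R).indicator
        (fun y => -(1 / 2 : ℝ) * (Real.sqrt (‖y‖ ^ 2 + ε ^ 2) ^ 3)⁻¹) x)) := by
  rcases lt_or_ge ‖x‖ R with hx | hx
  · -- inside: eventually `n(R² - |x|²) > 1`, so `S = 1` and `S' = 0`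
    rw [indicator_of_mem (by simpa using hx)]
    have hpos : 0 < R ^ 2 - ‖x‖ ^ 2 := by
      have : ‖x‖ ^ 2 < R ^ 2 := pow_lt_pow_left₀ hx (norm_nonneg _) two_ne_zero
      linarith
    obtain ⟨N, hN⟩ := exists_nat_gt (1 / (R ^ 2 - ‖x‖ ^ 2))
    refine tendsto_const_nhds.congr' ?_
    filter_upwards [eventually_ge_atTop N] with n hn
    have hn1 : 1 < (n : ℝ) * (R ^ 2 - ‖x‖ ^ 2) := by
      have hN' : 1 < (N : ℝ) * (R ^ 2 - ‖x‖ ^ 2) := by rwa [div_lt_iff₀ hpos] at hN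
      exact hN'.trans_le (mul_le_mul_of_nonneg_right (Nat.cast_le.2 hn) hpos.le)
    rw [Real.smoothTransition.one_of_one_le hn1.le, deriv_smoothTransition_of_one_lt hn1]
    ring
  · -- outside the open ball: every term is `0`
    rw [indicator_of_notMem (by simpa using hx)]
    rcases hx.eq_or_lt with h | h
    · refine tendsto_const_nhds.congr' (Eventually.of_forall fun n => ?_)
      have hpsi : (Real.sqrt (‖x‖ ^ 2 + ε ^ 2))⁻¹ - (Real.sqrt (R ^ 2 + ε ^ 2))⁻¹ = 0 := by
        rw [← h, sub_self]
      dsimp only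
      rw [smoothTransition_cutoff_eq_zero hR n hx, hpsi]
      simp
    · exact tendsto_const_nhds.congr' (Eventually.of_forall fun n =>
        (dprof_eq_zero_of_lt ε hR n h).symm)

/-- Pointwise limit of the profile: `H_n(|x|²) → (ψ_ε(|x|²) - ψ_ε(R²)) · 1_{B_R}(x)` for every `x`. [folklore] -/
private theorem tendsto_prof (ε : ℝ) {R : ℝ} (hR : 0 ≤ R) (x : EuclideanSpace ℝ (Fin 3)) :
    Tendsto (fun n : ℕ => ((Real.sqrt (‖x‖ ^ 2 + ε ^ 2))⁻¹ - (Real.sqrt (R ^ 2 + ε ^ 2))⁻¹) *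
        Real.smoothTransition (n * (R ^ 2 - ‖x‖ ^ 2))) atTop
      (𝓝 ((ball (0 : EuclideanSpace ℝ (Fin 3)) R).indicator
        (fun y => (Real.sqrt (‖y‖ ^ 2 + ε ^ 2))⁻¹ - (Real.sqrt (R ^ 2 + ε ^ 2))⁻¹) x)) := by
  rcases lt_or_ge ‖x‖ R with hx | hx
  · rw [indicator_of_mem (by simpa using hx)]
    have hpos : 0 < R ^ 2 - ‖x‖ ^ 2 := by
      have : ‖x‖ ^ 2 < R ^ 2 := pow_lt_pow_left₀ hx (norm_nonneg _) two_ne_zero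
      linarith
    obtain ⟨N, hN⟩ := exists_nat_gt (1 / (R ^ 2 - ‖x‖ ^ 2))
    refine tendsto_const_nhds.congr' ?_
    filter_upwards [eventually_ge_atTop N] with n hn
    have hn1 : 1 < (n : ℝ) * (R ^ 2 - ‖x‖ ^ 2) := by
      have hN' : 1 < (N : ℝ) * (R ^ 2 - ‖x‖ ^ 2) := by rwa [div_lt_iff₀ hpos] at hN
      exact hN'.trans_le (mul_le_mul_of_nonneg_right (Nat.cast_le.2 hn) hpos.le)
    rw [Real.smoothTransition.one_of_one_le hn1.le, mul_one]
  · rw [indicator_of_notMem (by simpa using hx)]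
    exact tendsto_const_nhds.congr' (Eventually.of_forall fun n => (prof_eq_zero_of_le ε hR n hx).symm)


/-- `|2⟪x,v⟫² - |x|²|v|²| ≤ 3|x|²|v|²` (Cauchy–Schwarz). [folklore] -/
private theorem abs_quad_le (x w : EuclideanSpace ℝ (Fin 3)) : |2 * ⟪x, w⟫ ^ 2 - ‖x‖ ^ 2 * ‖w‖ ^ 2| ≤ 3 * (‖x‖ ^ 2 * ‖w‖ ^ 2) := by
  have hcs : ⟪x, w⟫ ^ 2 ≤ ‖x‖ ^ 2 * ‖w‖ ^ 2 := by
    rw [← mul_pow, ← sq_abs]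
    exact pow_le_pow_left₀ (abs_nonneg _) (abs_real_inner_le_norm x w) 2
  have h0 : 0 ≤ ⟪x, w⟫ ^ 2 := sq_nonneg _
  rw [abs_le]
  constructor <;> nlinarith

/-! ### First limit `n → ∞`: the mean-value identity on the sharp ball with the weight `ψ_ε` -/

/-- For `ε, R > 0`:
`∫_{B_R} ψ_ε'(|x|²) (2⟪x,v⟫² - |x|²|v|²) dx = ½ ∫_{B_R} (ψ_ε(|x|²) - ψ_ε(R²)) |v|² dx`,
the limit `n → ∞` of `radial_identity` for the profiles `H_{ε,n}` (dominated convergence; the kink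
term `n (ψ_ε - ψ_ε(R²)) S'` is bounded by `|u S'(u)| ≤ M` and tends to `0` everywhere). [cite: ChaeWolf2016, Lemma 2.1 (2.5) with α = 1, smoothed] -/
private theorem step_eps (hv : ContDiff ℝ 1 v) (hdiv : VectorCalculus.IsDivFree v)
    (hconv : ∀ x, convect v v x = gradient (fun y => ‖v y‖ ^ 2 / 2) x)
    {ε R : ℝ} (hε : 0 < ε) (hR : 0 < R) :
    ∫ x in ball (0 : EuclideanSpace ℝ (Fin 3)) R, -(1 / 2 : ℝ) * (Real.sqrt (‖x‖ ^ 2 + ε ^ 2) ^ 3)⁻¹ *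
        (2 * ⟪x, v x⟫ ^ 2 - ‖x‖ ^ 2 * ‖v x‖ ^ 2) =
      (1 / 2 : ℝ) * ∫ x in ball (0 : EuclideanSpace ℝ (Fin 3)) R,
        ((Real.sqrt (‖x‖ ^ 2 + ε ^ 2))⁻¹ - (Real.sqrt (R ^ 2 + ε ^ 2))⁻¹) * ‖v x‖ ^ 2 := by
  obtain ⟨M, hM0, hM⟩ := exists_bound_mul_deriv_smoothTransition
  -- abbreviations: the derivative profile `A n x`, the profile `H n x`, the quadratic form `Q x`
  set A : ℕ → EuclideanSpace ℝ (Fin 3) → ℝ := fun n x => -(1 / 2 : ℝ) * (Real.sqrt (‖x‖ ^ 2 + ε ^ 2) ^ 3)⁻¹ *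
        Real.smoothTransition (n * (R ^ 2 - ‖x‖ ^ 2)) -
      n * ((Real.sqrt (‖x‖ ^ 2 + ε ^ 2))⁻¹ - (Real.sqrt (R ^ 2 + ε ^ 2))⁻¹) *
        deriv Real.smoothTransition (n * (R ^ 2 - ‖x‖ ^ 2)) with hA
  set H : ℕ → EuclideanSpace ℝ (Fin 3) → ℝ := fun n x => ((Real.sqrt (‖x‖ ^ 2 + ε ^ 2))⁻¹ -
      (Real.sqrt (R ^ 2 + ε ^ 2))⁻¹) * Real.smoothTransition (n * (R ^ 2 - ‖x‖ ^ 2)) with hH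
  set Q : EuclideanSpace ℝ (Fin 3) → ℝ := fun x => 2 * ⟪x, v x⟫ ^ 2 - ‖x‖ ^ 2 * ‖v x‖ ^ 2 with hQ
  -- the identity for each `n`, in explicit form
  have hid : ∀ n : ℕ, ∫ x, A n x * Q x = (1 / 2 : ℝ) * ∫ x, H n x * ‖v x‖ ^ 2 := by
    intro n
    have h := radial_identity hv hdiv hconv (contDiff_test hε R n) (hasCompactSupport_test ε hR.le n)
    rw [← h]
    refine integral_congr_ae (Eventually.of_forall fun x => ?_)
    simp only [hA, hQ, fderiv_test hε R n, real_inner_self_eq_norm_sq]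
    ring
  -- continuity of the integrands (for measurability)
  have hcontA : ∀ n, Continuous fun x => A n x * Q x := by
    intro n
    have hc : Continuous fun x => fderiv ℝ (H n) x := (contDiff_test hε R n).continuous_fderiv one_ne_zero
    have hc' : Continuous fun x => fderiv ℝ (H n) x (v x) * ⟪x, v x⟫ -
        (1 / 2 : ℝ) * fderiv ℝ (H n) x x * ‖v x‖ ^ 2 :=
      ((hc.clm_apply hv.continuous).mul (continuous_id.inner hv.continuous)).sub
        ((continuous_const.mul (hc.clm_apply continuous_id)).mul (hv.continuous.norm.pow 2))
    refine hc'.congr fun x => ?_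
    simp only [hA, hQ, hH, fderiv_test hε R n, real_inner_self_eq_norm_sq]
    ring
  have hcontH : ∀ n, Continuous fun x => H n x * ‖v x‖ ^ 2 := fun n =>
    (contDiff_test hε R n).continuous.mul (hv.continuous.norm.pow 2)
  -- limit of the left-hand sides
  have hL : Tendsto (fun n => ∫ x, A n x * Q x) atTop (𝓝 (∫ x, (ball (0 : EuclideanSpace ℝ (Fin 3)) R).indicator
      (fun x => -(1 / 2 : ℝ) * (Real.sqrt (‖x‖ ^ 2 + ε ^ 2) ^ 3)⁻¹ * Q x) x)) := by
    refine tendsto_integral_of_dominated_convergence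
      (fun x => (closedBall (0 : EuclideanSpace ℝ (Fin 3)) R).indicator
        (fun x => (1 / 2) * (ε ^ 3)⁻¹ * (1 + M) * (3 * (R ^ 2 * ‖v x‖ ^ 2))) x)
      (fun n => (hcontA n).aestronglyMeasurable) ?_ ?_ ?_
    · refine IntegrableOn.integrable_indicator ?_ measurableSet_closedBall
      exact (continuous_const.mul (continuous_const.mul (continuous_const.mul
        (hv.continuous.norm.pow 2)))).continuousOn.integrableOn_compact (isCompact_closedBall _ _)
    · intro n
      refine Eventually.of_forall fun x => ?_
      rw [Real.norm_eq_abs]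
      by_cases hx : ‖x‖ ≤ R
      · rw [indicator_of_mem (mem_closedBall_zero_iff.2 hx), abs_mul]
        have hQx : |Q x| ≤ 3 * (R ^ 2 * ‖v x‖ ^ 2) :=
          (abs_quad_le x (v x)).trans (by gcongr)
        exact mul_le_mul (abs_dprof_le hε R hM n (sq_nonneg ‖x‖)) hQx (abs_nonneg _)
          (by positivity)
      · rw [indicator_of_notMem (by rw [mem_closedBall_zero_iff]; exact hx), hA]
        dsimp only
        rw [dprof_eq_zero_of_lt ε hR.le n (lt_of_not_ge hx), zero_mul, abs_zero]
    · refine Eventually.of_forall fun x => ?_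
      have h := (tendsto_dprof ε hR.le x).mul_const (Q x)
      refine (h.congr fun n => rfl).trans ?_
      by_cases hx : x ∈ ball (0 : EuclideanSpace ℝ (Fin 3)) R
      · rw [indicator_of_mem hx, indicator_of_mem hx]
      · rw [indicator_of_notMem hx, indicator_of_notMem hx, zero_mul]
  -- limit of the right-hand sides
  have hRt : Tendsto (fun n => ∫ x, H n x * ‖v x‖ ^ 2) atTop (𝓝 (∫ x, (ball (0 : EuclideanSpace ℝ (Fin 3)) R).indicator
      (fun x => ((Real.sqrt (‖x‖ ^ 2 + ε ^ 2))⁻¹ - (Real.sqrt (R ^ 2 + ε ^ 2))⁻¹) * ‖v x‖ ^ 2)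
        x)) := by
    refine tendsto_integral_of_dominated_convergence
      (fun x => (closedBall (0 : EuclideanSpace ℝ (Fin 3)) R).indicator (fun x => 2 * ε⁻¹ * ‖v x‖ ^ 2) x)
      (fun n => (hcontH n).aestronglyMeasurable) ?_ ?_ ?_
    · refine IntegrableOn.integrable_indicator ?_ measurableSet_closedBall
      exact (continuous_const.mul (hv.continuous.norm.pow 2)).continuousOn.integrableOn_compact
        (isCompact_closedBall _ _)
    · intro n
      refine Eventually.of_forall fun x => ?_
      rw [Real.norm_eq_abs]
      by_cases hx : ‖x‖ ≤ R
      · rw [indicator_of_mem (mem_closedBall_zero_iff.2 hx), hH]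
        dsimp only
        rw [abs_mul, abs_mul, abs_of_nonneg (sq_nonneg ‖v x‖)]
        have h1 : |(Real.sqrt (‖x‖ ^ 2 + ε ^ 2))⁻¹ - (Real.sqrt (R ^ 2 + ε ^ 2))⁻¹| ≤ 2 * ε⁻¹ := by
          refine (abs_sub _ _).trans ?_
          rw [abs_of_nonneg (by positivity), abs_of_nonneg (by positivity)]
          have := psi_le_inv hε (sq_nonneg ‖x‖)
          have := psi_le_inv hε (sq_nonneg R)
          linarith
        have h2 : |Real.smoothTransition (n * (R ^ 2 - ‖x‖ ^ 2))| ≤ 1 := by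
          rw [abs_of_nonneg (Real.smoothTransition.nonneg _)]
          exact Real.smoothTransition.le_one _
        calc _ ≤ 2 * ε⁻¹ * 1 * ‖v x‖ ^ 2 := by gcongr
          _ = 2 * ε⁻¹ * ‖v x‖ ^ 2 := by ring
      · rw [indicator_of_notMem (by rw [mem_closedBall_zero_iff]; exact hx), hH]
        dsimp only
        rw [prof_eq_zero_of_le ε hR.le n (le_of_not_ge hx), zero_mul, abs_zero]
    · refine Eventually.of_forall fun x => ?_
      have h := (tendsto_prof ε hR.le x).mul_const (‖v x‖ ^ 2)
      refine (h.congr fun n => rfl).trans ?_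
      by_cases hx : x ∈ ball (0 : EuclideanSpace ℝ (Fin 3)) R
      · rw [indicator_of_mem hx, indicator_of_mem hx]
      · rw [indicator_of_notMem hx, indicator_of_notMem hx, zero_mul]
  -- conclude by uniqueness of limits
  have hL' : Tendsto (fun n => ∫ x, A n x * Q x) atTop (𝓝 ((1 / 2 : ℝ) * ∫ x,
      (ball (0 : EuclideanSpace ℝ (Fin 3)) R).indicator (fun x => ((Real.sqrt (‖x‖ ^ 2 + ε ^ 2))⁻¹ -
        (Real.sqrt (R ^ 2 + ε ^ 2))⁻¹) * ‖v x‖ ^ 2) x)) := by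
    rw [show (fun n => ∫ x, A n x * Q x) = fun n => (1 / 2 : ℝ) * ∫ x, H n x * ‖v x‖ ^ 2 from
      funext hid]
    exact hRt.const_mul _
  have huniq := tendsto_nhds_unique hL hL'
  rw [integral_indicator measurableSet_ball, integral_indicator measurableSet_ball] at huniq
  exact huniq


/-! ### Second limit `ε → 0`: Theorem 1.3 (2.12) -/

/-- `x ↦ 1/|x|` is integrable on every ball of `ℝ³` (polar coordinates: `r² · r⁻¹ = r`). [folklore] -/
private theorem integrableOn_inv_norm_ball_three (R : ℝ) :
    IntegrableOn (fun x : EuclideanSpace ℝ (Fin 3) => ‖x‖⁻¹) (ball (0 : EuclideanSpace ℝ (Fin 3)) R) := by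
  have h := (integrableOn_fun_norm_addHaar (volume : Measure (EuclideanSpace ℝ (Fin 3))) (f := fun y : ℝ => y⁻¹)
    (r := R)).2
  rw [finrank_euclideanSpace_fin] at h
  apply h
  have heq : EqOn (fun y : ℝ => y ^ (3 - 1) • y⁻¹) (fun y => y) (Ioo 0 R) := fun y hy => by
    have hy0 : y ≠ 0 := hy.1.ne'
    simp only [smul_eq_mul]
    field_simp
  rw [integrableOn_congr_fun heq measurableSet_Ioo]
  exact (continuous_id.integrableOn_Icc (a := 0) (b := R)).mono_set Ioo_subset_Icc_self

/-- A continuous `v` is bounded on the ball: `∃ C, ∀ x ∈ B_R, |v x| ≤ C`. [folklore] -/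
private theorem exists_bound_on_ball (hv : Continuous v) (R : ℝ) :
    ∃ C, 0 ≤ C ∧ ∀ x ∈ ball (0 : EuclideanSpace ℝ (Fin 3)) R, ‖v x‖ ≤ C := by
  obtain ⟨C, hC⟩ := (isCompact_closedBall (0 : EuclideanSpace ℝ (Fin 3)) R).exists_bound_of_continuousOn hv.continuousOn
  exact ⟨max C 0, le_max_right _ _, fun x hx => (hC x (ball_subset_closedBall hx)).trans (le_max_left _ _)⟩

/-- `|v|²/|x|` is integrable on balls for continuous `v`. [folklore] -/
private theorem integrableOn_norm_sq_mul_inv_norm_ball (hv : Continuous v) (R : ℝ) :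
    IntegrableOn (fun x : EuclideanSpace ℝ (Fin 3) => ‖v x‖ ^ 2 * ‖x‖⁻¹) (ball (0 : EuclideanSpace ℝ (Fin 3)) R) := by
  obtain ⟨C, hC0, hC⟩ := exists_bound_on_ball hv R
  refine Integrable.bdd_mul (c := C ^ 2) (integrableOn_inv_norm_ball_three R)
    ((hv.norm.pow 2).aestronglyMeasurable) ?_
  refine (ae_restrict_iff' measurableSet_ball).2 (Eventually.of_forall fun x hx => ?_)
  rw [Real.norm_eq_abs, abs_of_nonneg (sq_nonneg _)]
  exact pow_le_pow_left₀ (norm_nonneg _) (hC x hx) 2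

/-- `⟪x,v⟫²/|x|³ ≤ |v|²/|x|` (Cauchy–Schwarz; both sides vanish at `x = 0`). [folklore] -/
private theorem normalSq_div_le (x w : EuclideanSpace ℝ (Fin 3)) : ⟪x, w⟫ ^ 2 / ‖x‖ ^ 3 ≤ ‖w‖ ^ 2 * ‖x‖⁻¹ := by
  rcases eq_or_ne x 0 with hx | hx
  · simp [hx]
  · have hn : 0 < ‖x‖ := norm_pos_iff.2 hx
    have hcs : ⟪x, w⟫ ^ 2 ≤ ‖x‖ ^ 2 * ‖w‖ ^ 2 := by
      rw [← mul_pow, ← sq_abs]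
      exact pow_le_pow_left₀ (abs_nonneg _) (abs_real_inner_le_norm x w) 2
    rw [div_le_iff₀ (by positivity)]
    calc ⟪x, w⟫ ^ 2 ≤ ‖x‖ ^ 2 * ‖w‖ ^ 2 := hcs
      _ = ‖w‖ ^ 2 * ‖x‖⁻¹ * ‖x‖ ^ 3 := by field_simp

/-- `⟪x,v⟫²/|x|³` is integrable on balls for continuous `v`. [folklore] -/
private theorem integrableOn_normalSq_div_ball (hv : Continuous v) (R : ℝ) :
    IntegrableOn (fun x : EuclideanSpace ℝ (Fin 3) => ⟪x, v x⟫ ^ 2 / ‖x‖ ^ 3) (ball (0 : EuclideanSpace ℝ (Fin 3)) R) := by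
  refine (integrableOn_norm_sq_mul_inv_norm_ball hv R).mono' ?_
    (Eventually.of_forall fun x => ?_)
  · exact (((continuous_id.inner hv).pow 2).measurable.div
      ((continuous_norm.pow 3).measurable)).aestronglyMeasurable
  · rw [Real.norm_eq_abs, abs_of_nonneg (by positivity)]
    exact normalSq_div_le x (v x)

/-- **Chae–Wolf 2016, Theorem 1.3, (2.12)** — classical Beltrami flows, with EQUALITY.
For `v ∈ C¹(ℝ³;ℝ³)` divergence free with `(v·∇)v = ∇(½|v|²)` (e.g. a Beltrami field,
`IsBeltrami.convect_eq_gradient`) and every `R > 0`,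
`∫_{B_R} |v_N|²/|x| dx = (1/2R) ∫_{B_R} |v|² dx`, where `|v_N|²/|x| = ⟪x,v⟫²/|x|³`
(`v_N = (v·x/|x|) x/|x|` the radial part).  The printed statement, for `L²_loc` weak Beltrami flows,
is the inequality `≤` (the defect is `lim_{r→0+} φ(r) ≥ 0`, which vanishes for continuous `v`).
[cite: ChaeWolf2016, Theorem 1.3 (2.12) and its proof in §2 (equation numbers of arXiv:1506.04361)] -/
theorem integral_normalSq_div_norm_eq (hv : ContDiff ℝ 1 v) (hdiv : VectorCalculus.IsDivFree v)
    (hconv : ∀ x, convect v v x = gradient (fun y => ‖v y‖ ^ 2 / 2) x) {R : ℝ} (hR : 0 < R) :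
    ∫ x in ball (0 : EuclideanSpace ℝ (Fin 3)) R, ⟪x, v x⟫ ^ 2 / ‖x‖ ^ 3 =
      (2 * R)⁻¹ * ∫ x in ball (0 : EuclideanSpace ℝ (Fin 3)) R, ‖v x‖ ^ 2 := by
  have hvc : Continuous v := hv.continuous
  -- the sequence `ε_k = 1/(k+1)` and the identities `step_eps`
  set ε : ℕ → ℝ := fun k => 1 / ((k : ℝ) + 1) with hεdef
  have hεpos : ∀ k, 0 < ε k := fun k => by positivity
  have hεlim : Tendsto ε atTop (𝓝 0) := tendsto_one_div_add_atTop_nhds_zero_nat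
  set Q : EuclideanSpace ℝ (Fin 3) → ℝ := fun x => 2 * ⟪x, v x⟫ ^ 2 - ‖x‖ ^ 2 * ‖v x‖ ^ 2 with hQ
  have hid : ∀ k, ∫ x in ball (0 : EuclideanSpace ℝ (Fin 3)) R, -(1 / 2 : ℝ) * (Real.sqrt (‖x‖ ^ 2 + ε k ^ 2) ^ 3)⁻¹ * Q x
      = (1 / 2 : ℝ) * ∫ x in ball (0 : EuclideanSpace ℝ (Fin 3)) R,
        ((Real.sqrt (‖x‖ ^ 2 + ε k ^ 2))⁻¹ - (Real.sqrt (R ^ 2 + ε k ^ 2))⁻¹) * ‖v x‖ ^ 2 :=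
    fun k => step_eps hv hdiv hconv (hεpos k) hR
  -- the restricted measure and `x ≠ 0` a.e.
  set μ : Measure (EuclideanSpace ℝ (Fin 3)) := volume.restrict (ball (0 : EuclideanSpace ℝ (Fin 3)) R) with hμ
  have hae0 : ∀ᵐ x ∂μ, x ≠ 0 := by
    refine ae_restrict_of_ae ?_
    rw [ae_iff]
    simp
  -- integrable dominating function `2 |v|²/|x| + R⁻¹ |v|²` (split into the two pieces)
  have hI1 : Integrable (fun x => ‖v x‖ ^ 2 * ‖x‖⁻¹) μ := integrableOn_norm_sq_mul_inv_norm_ball hvc R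
  have hI2 : Integrable (fun x => ‖v x‖ ^ 2) μ :=
    (hvc.norm.pow 2).continuousOn.integrableOn_compact (isCompact_closedBall (0 : EuclideanSpace ℝ (Fin 3)) R)
      |>.mono_set ball_subset_closedBall
  -- pointwise limits of the weights, for `x ≠ 0`
  have hsqrt : ∀ {a : ℝ}, 0 ≤ a → Tendsto (fun k => Real.sqrt (a ^ 2 + ε k ^ 2)) atTop (𝓝 a) := by
    intro a ha
    have h1 : Tendsto (fun k => a ^ 2 + ε k ^ 2) atTop (𝓝 (a ^ 2)) := by
      simpa using tendsto_const_nhds.add ((hεlim.pow 2))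
    have h2 := h1.sqrt
    rwa [Real.sqrt_sq ha] at h2
  -- limit of the left-hand sides
  have hL : Tendsto (fun k => ∫ x in ball (0 : EuclideanSpace ℝ (Fin 3)) R,
      -(1 / 2 : ℝ) * (Real.sqrt (‖x‖ ^ 2 + ε k ^ 2) ^ 3)⁻¹ * Q x) atTop
      (𝓝 (∫ x in ball (0 : EuclideanSpace ℝ (Fin 3)) R, -(1 / 2 : ℝ) * (‖x‖ ^ 3)⁻¹ * Q x)) := by
    refine tendsto_integral_of_dominated_convergence (fun x => (3 / 2 : ℝ) * (‖v x‖ ^ 2 * ‖x‖⁻¹))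
      (fun k => ?_) (hI1.const_mul _) (fun k => ?_) ?_
    · refine Continuous.aestronglyMeasurable ?_
      have hc1 : Continuous fun x : EuclideanSpace ℝ (Fin 3) => Real.sqrt (‖x‖ ^ 2 + ε k ^ 2) ^ 3 :=
        ((continuous_norm.pow 2).add continuous_const).sqrt.pow 3
      have hc2 : Continuous fun x : EuclideanSpace ℝ (Fin 3) => (Real.sqrt (‖x‖ ^ 2 + ε k ^ 2) ^ 3)⁻¹ :=
        hc1.inv₀ fun x => pow_ne_zero 3 (Real.sqrt_pos.2 (by have := hεpos k; positivity)).ne'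
      have hcQ : Continuous Q := (continuous_const.mul ((continuous_id.inner hvc).pow 2)).sub
          ((continuous_norm.pow 2).mul (hvc.norm.pow 2))
      exact (continuous_const.mul hc2).mul hcQ
    · filter_upwards [hae0] with x hx
      have hn : 0 < ‖x‖ := norm_pos_iff.2 hx
      have hs : ‖x‖ ≤ Real.sqrt (‖x‖ ^ 2 + ε k ^ 2) := by
        calc ‖x‖ = Real.sqrt (‖x‖ ^ 2) := (Real.sqrt_sq hn.le).symm
          _ ≤ _ := Real.sqrt_le_sqrt (by nlinarith [sq_nonneg (ε k)])
      have h3 : (Real.sqrt (‖x‖ ^ 2 + ε k ^ 2) ^ 3)⁻¹ ≤ (‖x‖ ^ 3)⁻¹ :=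
        inv_anti₀ (by positivity) (pow_le_pow_left₀ hn.le hs 3)
      rw [Real.norm_eq_abs, abs_mul, abs_mul, abs_neg, abs_of_pos (by norm_num : (0:ℝ) < 1 / 2),
        abs_of_pos (by positivity)]
      calc 1 / 2 * (Real.sqrt (‖x‖ ^ 2 + ε k ^ 2) ^ 3)⁻¹ * |Q x|
          ≤ 1 / 2 * (‖x‖ ^ 3)⁻¹ * (3 * (‖x‖ ^ 2 * ‖v x‖ ^ 2)) := by
            gcongr
            exact abs_quad_le x (v x)
        _ = (3 / 2 : ℝ) * (‖v x‖ ^ 2 * ‖x‖⁻¹) := by field_simp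
    · filter_upwards [hae0] with x hx
      have hn : 0 < ‖x‖ := norm_pos_iff.2 hx
      refine ((tendsto_const_nhds.mul (((hsqrt hn.le).pow 3).inv₀ (by positivity))).mul
        tendsto_const_nhds).congr fun k => ?_
      rfl
  -- limit of the right-hand sides
  have hRt : Tendsto (fun k => ∫ x in ball (0 : EuclideanSpace ℝ (Fin 3)) R,
      ((Real.sqrt (‖x‖ ^ 2 + ε k ^ 2))⁻¹ - (Real.sqrt (R ^ 2 + ε k ^ 2))⁻¹) * ‖v x‖ ^ 2) atTop
      (𝓝 (∫ x in ball (0 : EuclideanSpace ℝ (Fin 3)) R, (‖x‖⁻¹ - R⁻¹) * ‖v x‖ ^ 2)) := by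
    refine tendsto_integral_of_dominated_convergence
      (fun x => ‖v x‖ ^ 2 * ‖x‖⁻¹ + R⁻¹ * ‖v x‖ ^ 2)
      (fun k => ?_) (hI1.add (hI2.const_mul _)) (fun k => ?_) ?_
    · refine Continuous.aestronglyMeasurable ?_
      have hc1 : Continuous fun x : EuclideanSpace ℝ (Fin 3) => Real.sqrt (‖x‖ ^ 2 + ε k ^ 2) :=
        ((continuous_norm.pow 2).add continuous_const).sqrt
      have hc2 : Continuous fun x : EuclideanSpace ℝ (Fin 3) => (Real.sqrt (‖x‖ ^ 2 + ε k ^ 2))⁻¹ :=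
        hc1.inv₀ fun x => (Real.sqrt_pos.2 (by have := hεpos k; positivity)).ne'
      exact (hc2.sub continuous_const).mul (hvc.norm.pow 2)
    · filter_upwards [hae0] with x hx
      have hn : 0 < ‖x‖ := norm_pos_iff.2 hx
      have h1 : (Real.sqrt (‖x‖ ^ 2 + ε k ^ 2))⁻¹ ≤ ‖x‖⁻¹ := by
        refine inv_anti₀ hn ?_
        calc ‖x‖ = Real.sqrt (‖x‖ ^ 2) := (Real.sqrt_sq hn.le).symm
          _ ≤ _ := Real.sqrt_le_sqrt (by nlinarith [sq_nonneg (ε k)])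
      have h2 : (Real.sqrt (R ^ 2 + ε k ^ 2))⁻¹ ≤ R⁻¹ := by
        refine inv_anti₀ hR ?_
        calc R = Real.sqrt (R ^ 2) := (Real.sqrt_sq hR.le).symm
          _ ≤ _ := Real.sqrt_le_sqrt (by nlinarith [sq_nonneg (ε k)])
      rw [Real.norm_eq_abs, abs_mul, abs_of_nonneg (sq_nonneg ‖v x‖)]
      calc |(Real.sqrt (‖x‖ ^ 2 + ε k ^ 2))⁻¹ - (Real.sqrt (R ^ 2 + ε k ^ 2))⁻¹| * ‖v x‖ ^ 2
          ≤ ((Real.sqrt (‖x‖ ^ 2 + ε k ^ 2))⁻¹ + (Real.sqrt (R ^ 2 + ε k ^ 2))⁻¹) * ‖v x‖ ^ 2 := by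
            gcongr
            refine (abs_sub _ _).trans ?_
            rw [abs_of_nonneg (by positivity), abs_of_nonneg (by positivity)]
        _ ≤ (‖x‖⁻¹ + R⁻¹) * ‖v x‖ ^ 2 := by gcongr
        _ = ‖v x‖ ^ 2 * ‖x‖⁻¹ + R⁻¹ * ‖v x‖ ^ 2 := by ring
    · filter_upwards [hae0] with x hx
      have hn : 0 < ‖x‖ := norm_pos_iff.2 hx
      exact (((hsqrt hn.le).inv₀ hn.ne').sub ((hsqrt hR.le).inv₀ hR.ne')).mul tendsto_const_nhds
  -- pass to the limit in `hid`
  have hL' : Tendsto (fun k => ∫ x in ball (0 : EuclideanSpace ℝ (Fin 3)) R,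
      -(1 / 2 : ℝ) * (Real.sqrt (‖x‖ ^ 2 + ε k ^ 2) ^ 3)⁻¹ * Q x) atTop
      (𝓝 ((1 / 2 : ℝ) * ∫ x in ball (0 : EuclideanSpace ℝ (Fin 3)) R, (‖x‖⁻¹ - R⁻¹) * ‖v x‖ ^ 2)) := by
    rw [show (fun k => ∫ x in ball (0 : EuclideanSpace ℝ (Fin 3)) R,
        -(1 / 2 : ℝ) * (Real.sqrt (‖x‖ ^ 2 + ε k ^ 2) ^ 3)⁻¹ * Q x) = fun k =>
        (1 / 2 : ℝ) * ∫ x in ball (0 : EuclideanSpace ℝ (Fin 3)) R, ((Real.sqrt (‖x‖ ^ 2 + ε k ^ 2))⁻¹ -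
          (Real.sqrt (R ^ 2 + ε k ^ 2))⁻¹) * ‖v x‖ ^ 2 from funext hid]
    exact hRt.const_mul _
  have hlim := tendsto_nhds_unique hL hL'
  -- unpack the limit identity
  have hI3 : Integrable (fun x => ⟪x, v x⟫ ^ 2 / ‖x‖ ^ 3) μ := integrableOn_normalSq_div_ball hvc R
  have e1 : ∫ x in ball (0 : EuclideanSpace ℝ (Fin 3)) R, -(1 / 2 : ℝ) * (‖x‖ ^ 3)⁻¹ * Q x =
      -(∫ x in ball (0 : EuclideanSpace ℝ (Fin 3)) R, ⟪x, v x⟫ ^ 2 / ‖x‖ ^ 3) +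
        (1 / 2 : ℝ) * ∫ x in ball (0 : EuclideanSpace ℝ (Fin 3)) R, ‖v x‖ ^ 2 * ‖x‖⁻¹ := by
    have hpt : ∀ x : EuclideanSpace ℝ (Fin 3), -(1 / 2 : ℝ) * (‖x‖ ^ 3)⁻¹ * Q x =
        -(⟪x, v x⟫ ^ 2 / ‖x‖ ^ 3) + (1 / 2 : ℝ) * (‖v x‖ ^ 2 * ‖x‖⁻¹) := by
      intro x
      simp only [hQ]
      rcases eq_or_ne x 0 with hx | hx
      · simp [hx]
      · have hn : ‖x‖ ≠ 0 := norm_ne_zero_iff.2 hx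
        field_simp
        ring
    simp_rw [hpt]
    rw [integral_add hI3.fun_neg (hI1.const_mul _), integral_neg, integral_const_mul]
  have e2 : ∫ x in ball (0 : EuclideanSpace ℝ (Fin 3)) R, (‖x‖⁻¹ - R⁻¹) * ‖v x‖ ^ 2 =
      (∫ x in ball (0 : EuclideanSpace ℝ (Fin 3)) R, ‖v x‖ ^ 2 * ‖x‖⁻¹) - R⁻¹ * ∫ x in ball (0 : EuclideanSpace ℝ (Fin 3)) R, ‖v x‖ ^ 2 := by
    have hpt : ∀ x : EuclideanSpace ℝ (Fin 3), (‖x‖⁻¹ - R⁻¹) * ‖v x‖ ^ 2 = ‖v x‖ ^ 2 * ‖x‖⁻¹ - R⁻¹ * ‖v x‖ ^ 2 :=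
      fun x => by ring
    simp_rw [hpt]
    rw [integral_sub hI1 (hI2.const_mul _), integral_const_mul]
  rw [e1, e2] at hlim
  have : ∫ x in ball (0 : EuclideanSpace ℝ (Fin 3)) R, ⟪x, v x⟫ ^ 2 / ‖x‖ ^ 3 =
      (1 / 2 : ℝ) * R⁻¹ * ∫ x in ball (0 : EuclideanSpace ℝ (Fin 3)) R, ‖v x‖ ^ 2 := by linarith
  rw [this, mul_inv]
  ring


/-! ### (2.11): the energy ratio `r ↦ r⁻¹ ∫_{B_r}|v|²` is nondecreasing; the annular bound -/

/-- **The display before (2.12)**: for `0 < r ≤ R`,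
`(2R)⁻¹ ∫_{B_R}|v|² - (2r)⁻¹ ∫_{B_r}|v|² = ∫_{B_R ∖ B_r} ⟪x,v⟫²/|x|³`
(printed: `2∫_{B_R∖B_r}|u_N|²/|x| = φ(R) - φ(r)`). [cite: ChaeWolf2016, proof of Theorem 1.3 in §2, first display ((2.8) with α = 1)] -/
theorem energyRatio_sub_eq (hv : ContDiff ℝ 1 v) (hdiv : VectorCalculus.IsDivFree v)
    (hconv : ∀ x, convect v v x = gradient (fun y => ‖v y‖ ^ 2 / 2) x) {r R : ℝ} (hr : 0 < r)
    (hrR : r ≤ R) :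
    (2 * R)⁻¹ * (∫ x in ball (0 : EuclideanSpace ℝ (Fin 3)) R, ‖v x‖ ^ 2) - (2 * r)⁻¹ * ∫ x in ball (0 : EuclideanSpace ℝ (Fin 3)) r, ‖v x‖ ^ 2 =
      ∫ x in ball (0 : EuclideanSpace ℝ (Fin 3)) R \ ball (0 : EuclideanSpace ℝ (Fin 3)) r, ⟪x, v x⟫ ^ 2 / ‖x‖ ^ 3 := by
  rw [← integral_normalSq_div_norm_eq hv hdiv hconv (hr.trans_le hrR),
    ← integral_normalSq_div_norm_eq hv hdiv hconv hr]
  exact (setIntegral_sdiff measurableSet_ball (integrableOn_normalSq_div_ball hv.continuous R)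
    (ball_subset_ball hrR)).symm

/-- **Chae–Wolf 2016, (2.11)**: for a classical Beltrami flow, `r ↦ r⁻¹ ∫_{B_r} |v|²` is
nondecreasing on `(0, ∞)` ("`φ' = (2/R)∫_{∂B_R}|u_N|² ≥ 0`"). [cite: ChaeWolf2016, (2.11)] -/
theorem energyRatio_mono (hv : ContDiff ℝ 1 v) (hdiv : VectorCalculus.IsDivFree v)
    (hconv : ∀ x, convect v v x = gradient (fun y => ‖v y‖ ^ 2 / 2) x) {r R : ℝ} (hr : 0 < r)
    (hrR : r ≤ R) :
    r⁻¹ * (∫ x in ball (0 : EuclideanSpace ℝ (Fin 3)) r, ‖v x‖ ^ 2) ≤ R⁻¹ * ∫ x in ball (0 : EuclideanSpace ℝ (Fin 3)) R, ‖v x‖ ^ 2 := by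
  have h := energyRatio_sub_eq hv hdiv hconv hr hrR
  have hnn : 0 ≤ ∫ x in ball (0 : EuclideanSpace ℝ (Fin 3)) R \ ball (0 : EuclideanSpace ℝ (Fin 3)) r, ⟪x, v x⟫ ^ 2 / ‖x‖ ^ 3 :=
    integral_nonneg fun x => by positivity
  rw [mul_inv, mul_inv] at h
  linarith

/-- `⟪x,v⟫²/|x|²` is integrable on bounded measurable sets for continuous `v`. [folklore] -/
private theorem integrableOn_normalSq_div_sq (hv : Continuous v) {s : Set (EuclideanSpace ℝ (Fin 3))} {R : ℝ}
    (hsub : s ⊆ ball (0 : EuclideanSpace ℝ (Fin 3)) R) :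
    IntegrableOn (fun x : EuclideanSpace ℝ (Fin 3) => ⟪x, v x⟫ ^ 2 / ‖x‖ ^ 2) s := by
  have hI2 : IntegrableOn (fun x => ‖v x‖ ^ 2) s volume :=
    ((hv.norm.pow 2).continuousOn.integrableOn_compact (isCompact_closedBall (0 : EuclideanSpace ℝ (Fin 3)) R)).mono_set
      (hsub.trans ball_subset_closedBall)
  refine hI2.mono' ?_ (Eventually.of_forall fun x => ?_)
  · exact (((continuous_id.inner hv).pow 2).measurable.div
      ((continuous_norm.pow 2).measurable)).aestronglyMeasurable
  · rw [Real.norm_eq_abs, abs_of_nonneg (by positivity)]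
    have := SereginSverak2002.tangential_nonneg (v x) x
    linarith

/-- **The bulk form of `φ(R) ≤ ∫_{∂B_R}|u_T|²`**: for a classical Beltrami flow and `R > 0`,
`∫_{B_R} |v|² ≤ ∫_{B_{2R} ∖ B_R} |v_T|²` with `|v_T|² = |v|² - ⟪x,v⟫²/|x|²` — from (2.12) on
`B_R` and `B_{2R}` and `1/|x| ≥ 1/(2R)` on the annulus.
[cite: ChaeWolf2016, (2.11) and proof of Theorem 1.3 p. 6] -/
theorem integral_ball_le_tangential_annulus (hv : ContDiff ℝ 1 v) (hdiv : VectorCalculus.IsDivFree v)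
    (hconv : ∀ x, convect v v x = gradient (fun y => ‖v y‖ ^ 2 / 2) x) {R : ℝ} (hR : 0 < R) :
    ∫ x in ball (0 : EuclideanSpace ℝ (Fin 3)) R, ‖v x‖ ^ 2 ≤
      ∫ x in ball (0 : EuclideanSpace ℝ (Fin 3)) (2 * R) \ ball (0 : EuclideanSpace ℝ (Fin 3)) R, (‖v x‖ ^ 2 - ⟪x, v x⟫ ^ 2 / ‖x‖ ^ 2) := by
  have hvc := hv.continuous
  have hR2 : R ≤ 2 * R := by linarith
  set A : Set (EuclideanSpace ℝ (Fin 3)) := ball (0 : EuclideanSpace ℝ (Fin 3)) (2 * R) \ ball (0 : EuclideanSpace ℝ (Fin 3)) R with hA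
  have hAm : MeasurableSet A := measurableSet_ball.diff measurableSet_ball
  have hAsub : A ⊆ ball (0 : EuclideanSpace ℝ (Fin 3)) (2 * R) := sdiff_subset
  -- integrability on the annulus
  have hIv : IntegrableOn (fun x => ‖v x‖ ^ 2) A volume :=
    ((hvc.norm.pow 2).continuousOn.integrableOn_compact (isCompact_closedBall (0 : EuclideanSpace ℝ (Fin 3)) (2 * R))
      ).mono_set (hAsub.trans ball_subset_closedBall)
  have hIP : IntegrableOn (fun x : EuclideanSpace ℝ (Fin 3) => ⟪x, v x⟫ ^ 2 / ‖x‖ ^ 2) A volume :=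
    integrableOn_normalSq_div_sq hvc hAsub
  have hIN : IntegrableOn (fun x : EuclideanSpace ℝ (Fin 3) => ⟪x, v x⟫ ^ 2 / ‖x‖ ^ 3) A volume :=
    (integrableOn_normalSq_div_ball hvc (2 * R)).mono_set hAsub
  -- (2.12) on both balls
  have h := energyRatio_sub_eq hv hdiv hconv hR hR2
  have hsplit : ∫ x in ball (0 : EuclideanSpace ℝ (Fin 3)) (2 * R), ‖v x‖ ^ 2 =
      (∫ x in ball (0 : EuclideanSpace ℝ (Fin 3)) R, ‖v x‖ ^ 2) + ∫ x in A, ‖v x‖ ^ 2 := by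
    have := setIntegral_sdiff (μ := volume) (f := fun x => ‖v x‖ ^ 2) measurableSet_ball
      (((hvc.norm.pow 2).continuousOn.integrableOn_compact (isCompact_closedBall (0 : EuclideanSpace ℝ (Fin 3)) (2 * R))
        ).mono_set ball_subset_closedBall) (ball_subset_ball hR2)
    rw [hA]; linarith
  -- on the annulus `⟪x,v⟫²/|x|³ ≥ (2R)⁻¹ ⟪x,v⟫²/|x|²`
  have hN : (2 * R)⁻¹ * ∫ x in A, ⟪x, v x⟫ ^ 2 / ‖x‖ ^ 2 ≤ ∫ x in A, ⟪x, v x⟫ ^ 2 / ‖x‖ ^ 3 := by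
    rw [← integral_const_mul]
    refine setIntegral_mono_on (hIP.const_mul _) hIN hAm fun x hx => ?_
    have hx2 : ‖x‖ < 2 * R := by simpa using hAsub hx
    have hx1 : R ≤ ‖x‖ := by
      have : x ∉ ball (0 : EuclideanSpace ℝ (Fin 3)) R := hx.2
      simpa using this
    have hn : 0 < ‖x‖ := hR.trans_le hx1
    have hn' : ‖x‖ ≠ 0 := hn.ne'
    have hP : 0 ≤ ⟪x, v x⟫ ^ 2 / ‖x‖ ^ 2 := by positivity
    have h3 : ⟪x, v x⟫ ^ 2 / ‖x‖ ^ 3 = ⟪x, v x⟫ ^ 2 / ‖x‖ ^ 2 * ‖x‖⁻¹ := by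
      field_simp
    rw [h3, mul_comm]
    exact mul_le_mul_of_nonneg_left (inv_anti₀ hn hx2.le) hP
  have hP0 : 0 ≤ ∫ x in A, ⟪x, v x⟫ ^ 2 / ‖x‖ ^ 2 := integral_nonneg fun x => by positivity
  rw [integral_sub hIv hIP]
  rw [hsplit] at h
  -- `h : (2(2R))⁻¹ (F₁ + F_A) - (2R)⁻¹ F₁ = N_A ≥ (2R)⁻¹ P_A`
  have h4 : (2 * (2 * R))⁻¹ = (1 / 2) * (2 * R)⁻¹ := by rw [mul_inv]; ring
  rw [h4] at h
  have key : (2 * R)⁻¹ * ((∫ x in A, ‖v x‖ ^ 2) - (∫ x in ball (0 : EuclideanSpace ℝ (Fin 3)) R, ‖v x‖ ^ 2)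
      - 2 * ∫ x in A, ⟪x, v x⟫ ^ 2 / ‖x‖ ^ 2) ≥ 0 := by nlinarith
  have h2R : 0 < (2 * R)⁻¹ := by positivity
  have := nonneg_of_mul_nonneg_right (by rwa [mul_comm] at key) h2R
  linarith

/-! ### Theorem 1.3, Liouville part (annular form of (2.13)) -/

/-- If `∫_{B_ρ} |v|² = 0` for every `ρ > 0` and `v` is continuous then `v ≡ 0`. [folklore] -/
private theorem eq_zero_of_integral_ball_eq_zero (hv : Continuous v)
    (h : ∀ ρ > 0, ∫ x in ball (0 : EuclideanSpace ℝ (Fin 3)) ρ, ‖v x‖ ^ 2 = 0) : v = 0 := by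
  funext x₀
  by_contra hx₀
  set ρ := ‖x₀‖ + 1 with hρ
  have hρ0 : 0 < ρ := by positivity
  have hI : IntegrableOn (fun x => ‖v x‖ ^ 2) (ball (0 : EuclideanSpace ℝ (Fin 3)) ρ) :=
    ((hv.norm.pow 2).continuousOn.integrableOn_compact (isCompact_closedBall (0 : EuclideanSpace ℝ (Fin 3)) ρ)).mono_set
      ball_subset_closedBall
  have hpos : 0 < ∫ x in ball (0 : EuclideanSpace ℝ (Fin 3)) ρ, ‖v x‖ ^ 2 := by
    rw [setIntegral_pos_iff_support_of_nonneg_ae (Eventually.of_forall fun x => by positivity) hI]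
    have hopen : IsOpen (Function.support (fun x => ‖v x‖ ^ 2) ∩ ball (0 : EuclideanSpace ℝ (Fin 3)) ρ) :=
      ((hv.norm.pow 2).isOpen_support).inter isOpen_ball
    refine hopen.measure_pos volume ⟨x₀, ?_, ?_⟩
    · rw [Function.mem_support]; exact pow_ne_zero 2 (norm_ne_zero_iff.2 hx₀)
    · rw [mem_ball_zero_iff, hρ]; linarith
  exact hpos.ne' (h ρ hρ0)

/-- **Chae–Wolf 2016, Theorem 1.3 (Liouville part), annular form.** Let `v ∈ C¹(ℝ³;ℝ³)` be
divergence free with `(v·∇)v = ∇(½|v|²)` (a classical Beltrami flow). If along some `R_k → ∞`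
`R_k⁻¹ ∫_{B_{2R_k} ∖ B_{R_k}} |v_T|² dx → 0` (`|v_T|² = |v|² - ⟪x,v⟫²/|x|²`, `v_T = v × x/|x|`),
then `v ≡ 0`.  (Printed with the weaker hypothesis `∫_{∂B_{R_k}}|v_T|² dS → 0` along one sequence
of spheres; the annular form here implies it along some `r_k ∈ [R_k, 2R_k]`.)
[cite: ChaeWolf2016, Theorem 1.3 (2.13)] -/
theorem eq_zero_of_tangential_annulus (hv : ContDiff ℝ 1 v) (hdiv : VectorCalculus.IsDivFree v)
    (hconv : ∀ x, convect v v x = gradient (fun y => ‖v y‖ ^ 2 / 2) x)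
    (Rk : ℕ → ℝ) (hRpos : ∀ k, 0 < Rk k) (hRk : Tendsto Rk atTop atTop)
    (htan : Tendsto (fun k => (Rk k)⁻¹ * ∫ x in ball (0 : EuclideanSpace ℝ (Fin 3)) (2 * Rk k) \ ball (0 : EuclideanSpace ℝ (Fin 3)) (Rk k),
      (‖v x‖ ^ 2 - ⟪x, v x⟫ ^ 2 / ‖x‖ ^ 2)) atTop (𝓝 0)) :
    v = 0 := by
  refine eq_zero_of_integral_ball_eq_zero hv.continuous fun ρ hρ => ?_
  -- `φ(ρ) ≤ φ(R_k) ≤ R_k⁻¹ T_k → 0`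
  have hle : ρ⁻¹ * ∫ x in ball (0 : EuclideanSpace ℝ (Fin 3)) ρ, ‖v x‖ ^ 2 ≤ 0 := by
    refine ge_of_tendsto htan ?_
    filter_upwards [hRk.eventually_ge_atTop ρ] with k hk
    exact (energyRatio_mono hv hdiv hconv hρ hk).trans (mul_le_mul_of_nonneg_left
      (integral_ball_le_tangential_annulus hv hdiv hconv (hRpos k)) (inv_pos.2 (hRpos k)).le)
  have hge : 0 ≤ ∫ x in ball (0 : EuclideanSpace ℝ (Fin 3)) ρ, ‖v x‖ ^ 2 := integral_nonneg fun x => by positivity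
  have h1 : ρ⁻¹ * ∫ x in ball (0 : EuclideanSpace ℝ (Fin 3)) ρ, ‖v x‖ ^ 2 ≤ ρ⁻¹ * 0 := by rw [mul_zero]; exact hle
  have := le_of_mul_le_mul_left h1 (inv_pos.2 hρ)
  linarith


/-! ### Remark 1.4: the three printed decay conditions -/

/-- Volume of the annulus: `|B_{2R} ∖ B_R| ≤ |B_{2R}| = 8R³|B₁|`. [folklore] -/
private theorem measureReal_annulus_le {R : ℝ} (hR : 0 < R) :
    volume.real (ball (0 : EuclideanSpace ℝ (Fin 3)) (2 * R) \ ball (0 : EuclideanSpace ℝ (Fin 3)) R) ≤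
      8 * R ^ 3 * volume.real (ball (0 : EuclideanSpace ℝ (Fin 3)) 1) := by
  calc volume.real (ball (0 : EuclideanSpace ℝ (Fin 3)) (2 * R) \ ball (0 : EuclideanSpace ℝ (Fin 3)) R)
      ≤ volume.real (ball (0 : EuclideanSpace ℝ (Fin 3)) (2 * R)) := measureReal_mono sdiff_subset
    _ = 8 * R ^ 3 * volume.real (ball (0 : EuclideanSpace ℝ (Fin 3)) 1) := by
        rw [measureReal_def, measureReal_def, Measure.addHaar_ball_of_pos volume (0 : EuclideanSpace ℝ (Fin 3))
          (by positivity : 0 < 2 * R), finrank_euclideanSpace_fin, ENNReal.toReal_mul,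
          ENNReal.toReal_ofReal (by positivity)]
        ring

/-- The integrals on the annuli `R_k = k+1` go to `∞`. [folklore] -/
private theorem tendsto_natCast_add_one : Tendsto (fun k : ℕ => (k : ℝ) + 1) atTop atTop :=
  tendsto_atTop_add_const_right _ _ tendsto_natCast_atTop_atTop

/-- **Chae–Wolf 2016, Remark 1.4 (i)** (classical frame): a classical Beltrami flow with
`|v_T(x)| = o(|x|⁻¹)`, i.e. `|x|² |v_T(x)|² → 0` as `|x| → ∞` (`|v_T|² = |v|² - ⟪x,v⟫²/|x|²`),
vanishes identically. [cite: ChaeWolf2016, Remark 1.4 (i)] -/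
theorem eq_zero_of_tangential_littleO (hv : ContDiff ℝ 1 v) (hdiv : VectorCalculus.IsDivFree v)
    (hconv : ∀ x, convect v v x = gradient (fun y => ‖v y‖ ^ 2 / 2) x)
    (hdec : Tendsto (fun x : EuclideanSpace ℝ (Fin 3) => ‖x‖ ^ 2 * (‖v x‖ ^ 2 - ⟪x, v x⟫ ^ 2 / ‖x‖ ^ 2))
      (cocompact (EuclideanSpace ℝ (Fin 3))) (𝓝 0)) :
    v = 0 := by
  have hvc := hv.continuous
  set V : ℝ := volume.real (ball (0 : EuclideanSpace ℝ (Fin 3)) 1) with hV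
  have hV0 : 0 ≤ V := measureReal_nonneg
  refine eq_zero_of_tangential_annulus hv hdiv hconv (fun k => (k : ℝ) + 1) (fun k => by positivity)
    tendsto_natCast_add_one ?_
  refine tendsto_order.2 ⟨fun a ha => Eventually.of_forall fun k => ha.trans_le ?_, fun a ha => ?_⟩
  · exact mul_nonneg (by positivity) (integral_nonneg fun x => SereginSverak2002.tangential_nonneg (v x) x)
  -- given `a > 0`, pick `δ` with `8 V δ < a` and `ρ₀` beyond which `|x|²|v_T|² < δ`
  obtain ⟨δ, hδ0, hδ⟩ : ∃ δ : ℝ, 0 < δ ∧ 8 * V * δ < a :=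
    ⟨a / (8 * V + 1), by positivity, by
      rw [mul_div_assoc']
      rw [div_lt_iff₀ (by positivity)]; nlinarith⟩
  have hev : ∀ᶠ x in cocompact (EuclideanSpace ℝ (Fin 3)), ‖x‖ ^ 2 * (‖v x‖ ^ 2 - ⟪x, v x⟫ ^ 2 / ‖x‖ ^ 2) < δ :=
    (tendsto_order.1 hdec).2 δ hδ0
  rw [← Metric.cobounded_eq_cocompact,
    (Metric.hasBasis_cobounded_compl_closedBall (0 : EuclideanSpace ℝ (Fin 3))).eventually_iff] at hev
  obtain ⟨ρ₀, -, hρ₀⟩ := hev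
  filter_upwards [tendsto_natCast_add_one.eventually_gt_atTop (max ρ₀ 0)] with k hk
  set R : ℝ := (k : ℝ) + 1 with hRdef
  have hR : 0 < R := (le_max_right _ _).trans_lt hk
  have hRρ : ρ₀ < R := (le_max_left _ _).trans_lt hk
  set A : Set (EuclideanSpace ℝ (Fin 3)) := ball (0 : EuclideanSpace ℝ (Fin 3)) (2 * R) \ ball (0 : EuclideanSpace ℝ (Fin 3)) R with hA
  have hAm : MeasurableSet A := measurableSet_ball.diff measurableSet_ball
  have hAsub : A ⊆ ball (0 : EuclideanSpace ℝ (Fin 3)) (2 * R) := sdiff_subset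
  have hIT : IntegrableOn (fun x => ‖v x‖ ^ 2 - ⟪x, v x⟫ ^ 2 / ‖x‖ ^ 2) A volume :=
    (((hvc.norm.pow 2).continuousOn.integrableOn_compact (isCompact_closedBall (0 : EuclideanSpace ℝ (Fin 3)) (2 * R))
      ).mono_set (hAsub.trans ball_subset_closedBall)).sub (integrableOn_normalSq_div_sq hvc hAsub)
  -- pointwise on the annulus: `|v_T|² ≤ δ/R²`
  have hpt : ∀ x ∈ A, ‖v x‖ ^ 2 - ⟪x, v x⟫ ^ 2 / ‖x‖ ^ 2 ≤ δ / R ^ 2 := by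
    intro x hx
    have hx1 : R ≤ ‖x‖ := by
      have : x ∉ ball (0 : EuclideanSpace ℝ (Fin 3)) R := hx.2
      simpa using this
    have hn : 0 < ‖x‖ := hR.trans_le hx1
    have hxρ : x ∈ (closedBall (0 : EuclideanSpace ℝ (Fin 3)) ρ₀)ᶜ := by
      rw [mem_compl_iff, mem_closedBall_zero_iff, not_le]; exact hRρ.trans_le hx1
    have h1 := (hρ₀ hxρ).le
    rw [le_div_iff₀ (by positivity)]
    calc (‖v x‖ ^ 2 - ⟪x, v x⟫ ^ 2 / ‖x‖ ^ 2) * R ^ 2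
        ≤ (‖v x‖ ^ 2 - ⟪x, v x⟫ ^ 2 / ‖x‖ ^ 2) * ‖x‖ ^ 2 :=
          mul_le_mul_of_nonneg_left (pow_le_pow_left₀ hR.le hx1 2) (SereginSverak2002.tangential_nonneg (v x) x)
      _ ≤ δ := by rw [mul_comm]; exact h1
  have hint : ∫ x in A, (‖v x‖ ^ 2 - ⟪x, v x⟫ ^ 2 / ‖x‖ ^ 2) ≤ δ / R ^ 2 * (8 * R ^ 3 * V) := by
    calc ∫ x in A, (‖v x‖ ^ 2 - ⟪x, v x⟫ ^ 2 / ‖x‖ ^ 2) ≤ ∫ x in A, δ / R ^ 2 :=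
          setIntegral_mono_on hIT (integrableOn_const (by
            rw [hA]; exact (measure_mono sdiff_subset).trans_lt measure_ball_lt_top |>.ne)) hAm hpt
      _ = volume.real A * (δ / R ^ 2) := by rw [setIntegral_const, smul_eq_mul]
      _ ≤ (8 * R ^ 3 * V) * (δ / R ^ 2) :=
          mul_le_mul_of_nonneg_right (measureReal_annulus_le hR) (by positivity)
      _ = δ / R ^ 2 * (8 * R ^ 3 * V) := mul_comm _ _
  calc R⁻¹ * ∫ x in A, (‖v x‖ ^ 2 - ⟪x, v x⟫ ^ 2 / ‖x‖ ^ 2)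
      ≤ R⁻¹ * (δ / R ^ 2 * (8 * R ^ 3 * V)) := mul_le_mul_of_nonneg_left hint (by positivity)
    _ = 8 * V * δ := by field_simp
    _ < a := hδ


/-- Tails of an integrable function: `∫_{|x| ≥ k+1} g → 0`. [folklore] -/
private theorem tendsto_integral_compl_ball {g : EuclideanSpace ℝ (Fin 3) → ℝ} (hg : Integrable g) :
    Tendsto (fun k : ℕ => ∫ x in (ball (0 : EuclideanSpace ℝ (Fin 3)) ((k : ℝ) + 1))ᶜ, g x) atTop (𝓝 0) := by
  have hanti : Antitone fun k : ℕ => (ball (0 : EuclideanSpace ℝ (Fin 3)) ((k : ℝ) + 1))ᶜ := fun i j hij =>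
    compl_subset_compl.2 (ball_subset_ball (by
      have : (i : ℝ) ≤ j := Nat.cast_le.2 hij
      linarith))
  have h := tendsto_setIntegral_of_antitone (μ := volume) (f := g)
    (fun k : ℕ => (measurableSet_ball (x := (0 : EuclideanSpace ℝ (Fin 3))) (ε := (k : ℝ) + 1)).compl) hanti
    ⟨0, hg.integrableOn⟩
  have hempty : (⋂ k : ℕ, (ball (0 : EuclideanSpace ℝ (Fin 3)) ((k : ℝ) + 1))ᶜ) = ∅ := by
    ext x
    simp only [mem_iInter, mem_compl_iff, mem_ball_zero_iff, not_lt, mem_empty_iff_false,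
      iff_false, not_forall, not_le]
    obtain ⟨k, hk⟩ := exists_nat_gt ‖x‖
    exact ⟨k, by linarith⟩
  rw [hempty, Measure.restrict_empty, integral_zero_measure] at h
  exact h

/-- On the annulus `R ≤ |x| ≤ 2R`: `|x|^μ ≤ 2^{max(μ,0)} R^μ`. [folklore] -/
private theorem rpow_le_on_annulus {μ R : ℝ} (hR : 0 < R) {x : EuclideanSpace ℝ (Fin 3)} (h1 : R ≤ ‖x‖) (h2 : ‖x‖ ≤ 2 * R) :
    ‖x‖ ^ μ ≤ (2 : ℝ) ^ (max μ 0) * R ^ μ := by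
  rcases le_or_gt 0 μ with hμ | hμ
  · rw [max_eq_left hμ]
    calc ‖x‖ ^ μ ≤ (2 * R) ^ μ := Real.rpow_le_rpow (norm_nonneg _) h2 hμ
      _ = 2 ^ μ * R ^ μ := Real.mul_rpow (by norm_num) hR.le
  · rw [max_eq_right hμ.le, Real.rpow_zero, one_mul]
    exact Real.rpow_le_rpow_of_nonpos hR h1 hμ.le

/-- **Chae–Wolf 2016, Remark 1.4 (iii)** (classical frame; Chae–Constantin 2015 for `μ ∈ [0,1]`
with `|u|²`): a classical Beltrami flow with `|v_T|²/|x|^μ ∈ L¹(ℝ³)` for some `μ ≤ 1`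
(`|v_T|² = |v|² - ⟪x,v⟫²/|x|²`) vanishes identically.
[cite: ChaeWolf2016, Remark 1.4 (iii)] -/
theorem eq_zero_of_tangential_weighted (hv : ContDiff ℝ 1 v) (hdiv : VectorCalculus.IsDivFree v)
    (hconv : ∀ x, convect v v x = gradient (fun y => ‖v y‖ ^ 2 / 2) x) {μ : ℝ} (hμ : μ ≤ 1)
    (hint : Integrable (fun x : EuclideanSpace ℝ (Fin 3) => (‖v x‖ ^ 2 - ⟪x, v x⟫ ^ 2 / ‖x‖ ^ 2) / ‖x‖ ^ μ)) :
    v = 0 := by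
  have hvc := hv.continuous
  set c : ℝ := (2 : ℝ) ^ (max μ 0) with hc
  have hc0 : 0 ≤ c := by positivity
  set tail : ℕ → ℝ := fun k => ∫ x in (ball (0 : EuclideanSpace ℝ (Fin 3)) ((k : ℝ) + 1))ᶜ,
    (‖v x‖ ^ 2 - ⟪x, v x⟫ ^ 2 / ‖x‖ ^ 2) / ‖x‖ ^ μ with htail
  have htail0 : Tendsto tail atTop (𝓝 0) := tendsto_integral_compl_ball hint
  refine eq_zero_of_tangential_annulus hv hdiv hconv (fun k => (k : ℝ) + 1) (fun k => by positivity)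
    tendsto_natCast_add_one ?_
  refine tendsto_of_tendsto_of_tendsto_of_le_of_le tendsto_const_nhds
    (by simpa using htail0.const_mul c) (fun k => ?_) (fun k => ?_)
  · exact mul_nonneg (by positivity) (integral_nonneg fun x => SereginSverak2002.tangential_nonneg (v x) x)
  · -- `R⁻¹ ∫_A |v_T|² ≤ c R^{μ-1} tail ≤ c · tail`
    set R : ℝ := (k : ℝ) + 1 with hRdef
    have hR : 0 < R := by positivity
    have hR1 : 1 ≤ R := by rw [hRdef]; linarith [(Nat.cast_nonneg k : (0 : ℝ) ≤ k)]
    set A : Set (EuclideanSpace ℝ (Fin 3)) := ball (0 : EuclideanSpace ℝ (Fin 3)) (2 * R) \ ball (0 : EuclideanSpace ℝ (Fin 3)) R with hA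
    have hAm : MeasurableSet A := measurableSet_ball.diff measurableSet_ball
    have hAsub : A ⊆ ball (0 : EuclideanSpace ℝ (Fin 3)) (2 * R) := sdiff_subset
    have hAsub' : A ⊆ (ball (0 : EuclideanSpace ℝ (Fin 3)) R)ᶜ := fun x hx => hx.2
    have hIT : IntegrableOn (fun x => ‖v x‖ ^ 2 - ⟪x, v x⟫ ^ 2 / ‖x‖ ^ 2) A volume :=
      (((hvc.norm.pow 2).continuousOn.integrableOn_compact (isCompact_closedBall (0 : EuclideanSpace ℝ (Fin 3)) (2 * R))
        ).mono_set (hAsub.trans ball_subset_closedBall)).sub (integrableOn_normalSq_div_sq hvc hAsub)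
    have hpt : ∀ x ∈ A, ‖v x‖ ^ 2 - ⟪x, v x⟫ ^ 2 / ‖x‖ ^ 2 ≤
        c * R ^ μ * ((‖v x‖ ^ 2 - ⟪x, v x⟫ ^ 2 / ‖x‖ ^ 2) / ‖x‖ ^ μ) := by
      intro x hx
      have hx1 : R ≤ ‖x‖ := by
        have : x ∉ ball (0 : EuclideanSpace ℝ (Fin 3)) R := hx.2
        simpa using this
      have hx2 : ‖x‖ ≤ 2 * R := by
        have : x ∈ ball (0 : EuclideanSpace ℝ (Fin 3)) (2 * R) := hAsub hx
        exact (mem_ball_zero_iff.1 this).le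
      have hn : 0 < ‖x‖ := hR.trans_le hx1
      have hxμ : 0 < ‖x‖ ^ μ := Real.rpow_pos_of_pos hn μ
      have hT := SereginSverak2002.tangential_nonneg (v x) x
      calc ‖v x‖ ^ 2 - ⟪x, v x⟫ ^ 2 / ‖x‖ ^ 2
          = ‖x‖ ^ μ * ((‖v x‖ ^ 2 - ⟪x, v x⟫ ^ 2 / ‖x‖ ^ 2) / ‖x‖ ^ μ) := by
            field_simp
        _ ≤ c * R ^ μ * ((‖v x‖ ^ 2 - ⟪x, v x⟫ ^ 2 / ‖x‖ ^ 2) / ‖x‖ ^ μ) :=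
            mul_le_mul_of_nonneg_right (rpow_le_on_annulus hR hx1 hx2) (div_nonneg hT hxμ.le)
    have h1 : ∫ x in A, (‖v x‖ ^ 2 - ⟪x, v x⟫ ^ 2 / ‖x‖ ^ 2) ≤ c * R ^ μ * tail k := by
      calc ∫ x in A, (‖v x‖ ^ 2 - ⟪x, v x⟫ ^ 2 / ‖x‖ ^ 2)
          ≤ ∫ x in A, c * R ^ μ * ((‖v x‖ ^ 2 - ⟪x, v x⟫ ^ 2 / ‖x‖ ^ 2) / ‖x‖ ^ μ) :=
            setIntegral_mono_on hIT ((hint.integrableOn).const_mul _) hAm hpt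
        _ = c * R ^ μ * ∫ x in A, (‖v x‖ ^ 2 - ⟪x, v x⟫ ^ 2 / ‖x‖ ^ 2) / ‖x‖ ^ μ :=
            integral_const_mul _ _
        _ ≤ c * R ^ μ * tail k := by
            refine mul_le_mul_of_nonneg_left ?_ (by positivity)
            exact setIntegral_mono_set hint.integrableOn
              (Eventually.of_forall fun x => div_nonneg (SereginSverak2002.tangential_nonneg (v x) x)
                (Real.rpow_nonneg (norm_nonneg _) _)) (Eventually.of_forall hAsub')
    have h2 : R⁻¹ * (c * R ^ μ) ≤ c := by
      have : R ^ μ * R⁻¹ ≤ 1 := by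
        rw [← Real.rpow_neg_one, ← Real.rpow_add hR]
        exact Real.rpow_le_one_of_one_le_of_nonpos hR1 (by linarith)
      calc R⁻¹ * (c * R ^ μ) = c * (R ^ μ * R⁻¹) := by ring
        _ ≤ c * 1 := mul_le_mul_of_nonneg_left this hc0
        _ = c := mul_one c
    have htk : 0 ≤ tail k := integral_nonneg fun x => div_nonneg (SereginSverak2002.tangential_nonneg (v x) x)
      (Real.rpow_nonneg (norm_nonneg _) _)
    calc R⁻¹ * ∫ x in A, (‖v x‖ ^ 2 - ⟪x, v x⟫ ^ 2 / ‖x‖ ^ 2) ≤ R⁻¹ * (c * R ^ μ * tail k) :=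
          mul_le_mul_of_nonneg_left h1 (by positivity)
      _ = R⁻¹ * (c * R ^ μ) * tail k := by ring
      _ ≤ c * tail k := mul_le_mul_of_nonneg_right h2 htk

/-- For `T ≥ 0`, `λ > 0`, `p ≥ 1`: `T ≤ λ + λ^{1-p} T^p` (split at the level `T = λ`). [folklore] -/
private theorem le_add_rpow_mul_rpow {T lam p : ℝ} (hT : 0 ≤ T) (hlam : 0 < lam) (hp : 1 ≤ p) :
    T ≤ lam + lam ^ (1 - p) * T ^ p := by
  rcases le_or_gt T lam with h | h
  · exact h.trans (le_add_of_nonneg_right (by positivity))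
  · have hT0 : 0 < T := hlam.trans h
    have h1 : lam ^ (p - 1) ≤ T ^ (p - 1) := Real.rpow_le_rpow hlam.le h.le (by linarith)
    have h2 : lam ^ (p - 1) * T ≤ T ^ p := by
      calc lam ^ (p - 1) * T ≤ T ^ (p - 1) * T := mul_le_mul_of_nonneg_right h1 hT
        _ = T ^ p := by rw [Real.rpow_sub_one hT0.ne', div_mul_cancel₀ _ hT0.ne']
    have h3 : T ≤ lam ^ (1 - p) * T ^ p := by
      rw [show (1 - p) = -(p - 1) by ring, Real.rpow_neg hlam.le, ← div_eq_inv_mul,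
        le_div_iff₀ (Real.rpow_pos_of_pos hlam _), mul_comm]
      exact h2
    exact h3.trans (le_add_of_nonneg_left hlam.le)

/-- **Chae–Wolf 2016, Remark 1.4 (ii)** (classical frame; Nadirashvili 2014 with `u` in place of
`u_T`): a classical Beltrami flow with `|v_T| ∈ L^q(ℝ³)` for some `q ∈ [2,3]`, i.e.
`(|v|² - ⟪x,v⟫²/|x|²)^{q/2} ∈ L¹`, vanishes identically.  (Proof: on the annulus `B_{2R}∖B_R`
split `|v_T|²` at the level `θR⁻²`; the exponent `2 - 6/q ≤ 0` is where `q ≤ 3` enters.)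
[cite: ChaeWolf2016, Remark 1.4 (ii)] -/
theorem eq_zero_of_tangential_Lq (hv : ContDiff ℝ 1 v) (hdiv : VectorCalculus.IsDivFree v)
    (hconv : ∀ x, convect v v x = gradient (fun y => ‖v y‖ ^ 2 / 2) x) {q : ℝ} (hq2 : 2 ≤ q)
    (hq3 : q ≤ 3)
    (hint : Integrable (fun x : EuclideanSpace ℝ (Fin 3) => (‖v x‖ ^ 2 - ⟪x, v x⟫ ^ 2 / ‖x‖ ^ 2) ^ (q / 2))) :
    v = 0 := by
  have hvc := hv.continuous
  set p : ℝ := q / 2 with hp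
  have hp1 : 1 ≤ p := by rw [hp]; linarith
  have hp32 : p - 1 ≤ 2⁻¹ := by rw [hp]; linarith
  set V : ℝ := volume.real (ball (0 : EuclideanSpace ℝ (Fin 3)) 1) with hV
  have hV0 : 0 ≤ V := measureReal_nonneg
  set tail : ℕ → ℝ := fun k => ∫ x in (ball (0 : EuclideanSpace ℝ (Fin 3)) ((k : ℝ) + 1))ᶜ,
    (‖v x‖ ^ 2 - ⟪x, v x⟫ ^ 2 / ‖x‖ ^ 2) ^ p with htail
  have htail0 : Tendsto tail atTop (𝓝 0) := tendsto_integral_compl_ball hint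
  refine eq_zero_of_tangential_annulus hv hdiv hconv (fun k => (k : ℝ) + 1) (fun k => by positivity)
    tendsto_natCast_add_one ?_
  refine tendsto_order.2 ⟨fun a ha => Eventually.of_forall fun k => ha.trans_le ?_, fun a ha => ?_⟩
  · exact mul_nonneg (by positivity) (integral_nonneg fun x => SereginSverak2002.tangential_nonneg (v x) x)
  -- given `a > 0`: the level `θ` with `8Vθ < a/2`, then `k` large so that `θ^{1-p} tail_k < a/2`
  obtain ⟨θ, hθ0, hθ⟩ : ∃ θ : ℝ, 0 < θ ∧ 8 * V * θ < a / 2 :=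
    ⟨a / (16 * V + 2), by positivity, by
      rw [mul_div_assoc', div_lt_iff₀ (by positivity)]; nlinarith⟩
  have hev : ∀ᶠ k in atTop, θ ^ (1 - p) * tail k < a / 2 := by
    have := (htail0.const_mul (θ ^ (1 - p)))
    rw [mul_zero] at this
    exact (tendsto_order.1 this).2 _ (by positivity)
  filter_upwards [hev] with k hk
  set R : ℝ := (k : ℝ) + 1 with hRdef
  have hR : 0 < R := by positivity
  have hR1 : 1 ≤ R := by rw [hRdef]; linarith [(Nat.cast_nonneg k : (0 : ℝ) ≤ k)]
  set A : Set (EuclideanSpace ℝ (Fin 3)) := ball (0 : EuclideanSpace ℝ (Fin 3)) (2 * R) \ ball (0 : EuclideanSpace ℝ (Fin 3)) R with hA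
  have hAm : MeasurableSet A := measurableSet_ball.diff measurableSet_ball
  have hAsub : A ⊆ ball (0 : EuclideanSpace ℝ (Fin 3)) (2 * R) := sdiff_subset
  have hAsub' : A ⊆ (ball (0 : EuclideanSpace ℝ (Fin 3)) R)ᶜ := fun x hx => hx.2
  have hAfin : volume A ≠ ⊤ := ((measure_mono hAsub).trans_lt measure_ball_lt_top).ne
  have hIT : IntegrableOn (fun x => ‖v x‖ ^ 2 - ⟪x, v x⟫ ^ 2 / ‖x‖ ^ 2) A volume :=
    (((hvc.norm.pow 2).continuousOn.integrableOn_compact (isCompact_closedBall (0 : EuclideanSpace ℝ (Fin 3)) (2 * R))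
      ).mono_set (hAsub.trans ball_subset_closedBall)).sub (integrableOn_normalSq_div_sq hvc hAsub)
  -- the level `λ = θ/R²` and the split `T ≤ λ + λ^{1-p} T^p`
  set lam : ℝ := θ * (R ^ 2)⁻¹ with hlam
  have hlam0 : 0 < lam := by positivity
  have hpt : ∀ x ∈ A, ‖v x‖ ^ 2 - ⟪x, v x⟫ ^ 2 / ‖x‖ ^ 2 ≤
      lam + lam ^ (1 - p) * (‖v x‖ ^ 2 - ⟪x, v x⟫ ^ 2 / ‖x‖ ^ 2) ^ p := fun x _ =>
    le_add_rpow_mul_rpow (SereginSverak2002.tangential_nonneg (v x) x) hlam0 hp1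
  have hIrhs : IntegrableOn (fun x => lam + lam ^ (1 - p) *
      (‖v x‖ ^ 2 - ⟪x, v x⟫ ^ 2 / ‖x‖ ^ 2) ^ p) A volume :=
    (integrableOn_const hAfin).add ((hint.integrableOn).const_mul _)
  have h1 : ∫ x in A, (‖v x‖ ^ 2 - ⟪x, v x⟫ ^ 2 / ‖x‖ ^ 2) ≤
      lam * (8 * R ^ 3 * V) + lam ^ (1 - p) * tail k := by
    calc ∫ x in A, (‖v x‖ ^ 2 - ⟪x, v x⟫ ^ 2 / ‖x‖ ^ 2)
        ≤ ∫ x in A, (lam + lam ^ (1 - p) * (‖v x‖ ^ 2 - ⟪x, v x⟫ ^ 2 / ‖x‖ ^ 2) ^ p) :=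
          setIntegral_mono_on hIT hIrhs hAm hpt
      _ = volume.real A * lam + lam ^ (1 - p) *
            ∫ x in A, (‖v x‖ ^ 2 - ⟪x, v x⟫ ^ 2 / ‖x‖ ^ 2) ^ p := by
          have hI1 : Integrable (fun _ : EuclideanSpace ℝ (Fin 3) => lam) (volume.restrict A) := integrableOn_const hAfin
          have hI2 : Integrable (fun x : EuclideanSpace ℝ (Fin 3) => lam ^ (1 - p) *
              (‖v x‖ ^ 2 - ⟪x, v x⟫ ^ 2 / ‖x‖ ^ 2) ^ p) (volume.restrict A) :=
            (hint.integrableOn).const_mul _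
          rw [integral_add hI1 hI2, setIntegral_const, smul_eq_mul, integral_const_mul]
      _ ≤ (8 * R ^ 3 * V) * lam + lam ^ (1 - p) * tail k := by
          gcongr
          · exact measureReal_annulus_le hR
          · exact setIntegral_mono_set hint.integrableOn
              (Eventually.of_forall fun x => Real.rpow_nonneg (SereginSverak2002.tangential_nonneg (v x) x) _)
              (Eventually.of_forall hAsub')
      _ = lam * (8 * R ^ 3 * V) + lam ^ (1 - p) * tail k := by ring
  -- `R⁻¹ λ 8R³V = 8Vθ` and `R⁻¹ λ^{1-p} ≤ θ^{1-p}`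
  have e1 : R⁻¹ * (lam * (8 * R ^ 3 * V)) = 8 * V * θ := by
    rw [hlam]; field_simp
  have e2 : R⁻¹ * lam ^ (1 - p) ≤ θ ^ (1 - p) := by
    have hsq : (R ^ 2) ^ (2⁻¹ : ℝ) = R := by
      have := Real.pow_rpow_inv_natCast hR.le (n := 2) two_ne_zero
      simpa using this
    have hR2 : 1 ≤ R ^ 2 := by nlinarith
    have h3 : (R ^ 2) ^ (p - 1) * R⁻¹ ≤ 1 := by
      calc (R ^ 2) ^ (p - 1) * R⁻¹ ≤ (R ^ 2) ^ (2⁻¹ : ℝ) * R⁻¹ :=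
            mul_le_mul_of_nonneg_right (Real.rpow_le_rpow_of_exponent_le hR2 hp32) (by positivity)
        _ = 1 := by rw [hsq, mul_inv_cancel₀ hR.ne']
    have h4 : lam ^ (1 - p) = θ ^ (1 - p) * (R ^ 2) ^ (p - 1) := by
      rw [hlam, Real.mul_rpow hθ0.le (by positivity), Real.inv_rpow (by positivity),
        ← Real.rpow_neg (by positivity), neg_sub]
    calc R⁻¹ * lam ^ (1 - p) = θ ^ (1 - p) * ((R ^ 2) ^ (p - 1) * R⁻¹) := by rw [h4]; ring
      _ ≤ θ ^ (1 - p) * 1 := mul_le_mul_of_nonneg_left h3 (by positivity)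
      _ = θ ^ (1 - p) := mul_one _
  have htk : 0 ≤ tail k :=
    integral_nonneg fun x => Real.rpow_nonneg (SereginSverak2002.tangential_nonneg (v x) x) _
  calc R⁻¹ * ∫ x in A, (‖v x‖ ^ 2 - ⟪x, v x⟫ ^ 2 / ‖x‖ ^ 2)
      ≤ R⁻¹ * (lam * (8 * R ^ 3 * V) + lam ^ (1 - p) * tail k) :=
        mul_le_mul_of_nonneg_left h1 (by positivity)
    _ = 8 * V * θ + R⁻¹ * lam ^ (1 - p) * tail k := by rw [mul_add, e1]; ring
    _ ≤ 8 * V * θ + θ ^ (1 - p) * tail k := by gcongr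
    _ < a / 2 + a / 2 := add_lt_add hθ hk
    _ = a := by ring


/-! ### Remark 1.5: in the `|v| ≤ K/|x|` class the radial part has finite weighted energy -/

/-- **Chae–Wolf 2016, Remark 1.5 (second half)**: for a classical Beltrami flow with
`|x| |v(x)| ≤ K`, `∫_{B_R} |v_N|²/|x| dx ≤ (1/2R) K² ∫_{B_R} |x|⁻² = (3/2)|B₁| K² = 2πK²` for every
`R > 0` (so `∫_{ℝ³}|v_N|²/|x| < ∞`, while for a non-trivial such flow `∫|v_T|²/|x| = +∞` by
Remark 1.4 (iii)). [cite: ChaeWolf2016, Remark 1.5] -/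
theorem integral_normalSq_div_norm_le_of_decay (hv : ContDiff ℝ 1 v)
    (hdiv : VectorCalculus.IsDivFree v)
    (hconv : ∀ x, convect v v x = gradient (fun y => ‖v y‖ ^ 2 / 2) x) {K : ℝ}
    (hK : ∀ x, ‖x‖ * ‖v x‖ ≤ K) {R : ℝ} (hR : 0 < R) :
    ∫ x in ball (0 : EuclideanSpace ℝ (Fin 3)) R, ⟪x, v x⟫ ^ 2 / ‖x‖ ^ 3 ≤
      (3 / 2 : ℝ) * volume.real (ball (0 : EuclideanSpace ℝ (Fin 3)) 1) * K ^ 2 := by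
  have hE : Module.finrank ℝ (EuclideanSpace ℝ (Fin 3)) = 3 := finrank_euclideanSpace_fin
  rw [integral_normalSq_div_norm_eq hv hdiv hconv hR]
  have hI1 : IntegrableOn (fun x => ‖v x‖ ^ 2) (ball (0 : EuclideanSpace ℝ (Fin 3)) R) :=
    ((hv.continuous.norm.pow 2).continuousOn.integrableOn_compact (isCompact_closedBall (0 : EuclideanSpace ℝ (Fin 3)) R)
      ).mono_set ball_subset_closedBall
  have hI2 : IntegrableOn (fun x : EuclideanSpace ℝ (Fin 3) => K ^ 2 * (‖x‖ ^ 2)⁻¹) (ball (0 : EuclideanSpace ℝ (Fin 3)) R) :=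
    (FunctionSpaces.FourierProductLaw.integrableOn_inv_norm_sq_ball hE R).const_mul _
  have hae : ∀ᵐ x ∂(volume.restrict (ball (0 : EuclideanSpace ℝ (Fin 3)) R)), ‖v x‖ ^ 2 ≤ K ^ 2 * (‖x‖ ^ 2)⁻¹ := by
    have h0 : ∀ᵐ x ∂(volume.restrict (ball (0 : EuclideanSpace ℝ (Fin 3)) R)), x ≠ 0 := by
      refine ae_restrict_of_ae ?_
      rw [ae_iff]; simp
    filter_upwards [h0] with x hx
    have hn : 0 < ‖x‖ := norm_pos_iff.2 hx
    have h1 : ‖v x‖ ≤ K / ‖x‖ := by rw [le_div_iff₀ hn, mul_comm]; exact hK x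
    have hK0 : 0 ≤ K := (mul_nonneg (norm_nonneg _) (norm_nonneg _)).trans (hK x)
    calc ‖v x‖ ^ 2 ≤ (K / ‖x‖) ^ 2 := pow_le_pow_left₀ (norm_nonneg _) h1 2
      _ = K ^ 2 * (‖x‖ ^ 2)⁻¹ := by rw [div_pow, div_eq_mul_inv]
  have hle : ∫ x in ball (0 : EuclideanSpace ℝ (Fin 3)) R, ‖v x‖ ^ 2 ≤ ∫ x in ball (0 : EuclideanSpace ℝ (Fin 3)) R, K ^ 2 * (‖x‖ ^ 2)⁻¹ :=
    integral_mono_ae hI1 hI2 hae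
  rw [integral_const_mul, FunctionSpaces.FourierProductLaw.integral_inv_norm_sq_ball hE hR.le,
    ← measureReal_def] at hle
  calc (2 * R)⁻¹ * ∫ x in ball (0 : EuclideanSpace ℝ (Fin 3)) R, ‖v x‖ ^ 2
      ≤ (2 * R)⁻¹ * (K ^ 2 * (3 * volume.real (ball (0 : EuclideanSpace ℝ (Fin 3)) 1) * R)) :=
        mul_le_mul_of_nonneg_left hle (by positivity)
    _ = (3 / 2 : ℝ) * volume.real (ball (0 : EuclideanSpace ℝ (Fin 3)) 1) * K ^ 2 := by field_simp

/-! ### The statements for the tree's `IsBeltrami` predicate (Majda–Bertozzi Def. 2.1) -/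

/-- A `C¹` Beltrami field has `(v·∇)v = ∇(½|v|²)` everywhere (Majda–Bertozzi Prop. 2.10).
[cite: MajdaBertozziCUP2002, §2.3.2 Prop. 2.10 (proof)] -/
theorem _root_.Literature.Analysis.FluidPDE.IsBeltrami.convect_eq_gradient_of_contDiff
    {lam : EuclideanSpace ℝ (Fin 3) → ℝ} (h : IsBeltrami v lam) (hv : ContDiff ℝ 1 v) (x : EuclideanSpace ℝ (Fin 3)) :
    convect v v x = gradient (fun y => ‖v y‖ ^ 2 / 2) x :=
  h.convect_eq_gradient (hv.differentiable one_ne_zero x)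

/-- **Chae–Wolf 2016, Theorem 1.3 (2.12)** for the tree's Beltrami predicate: a `C¹`
divergence-free Beltrami field `curl v = λ v` satisfies `∫_{B_R}|v_N|²/|x| = (2R)⁻¹∫_{B_R}|v|²`.
[cite: ChaeWolf2016, Theorem 1.3 (2.12)] -/
theorem _root_.Literature.Analysis.FluidPDE.IsBeltrami.integral_normalSq_div_norm_eq
    {lam : EuclideanSpace ℝ (Fin 3) → ℝ} (h : IsBeltrami v lam) (hv : ContDiff ℝ 1 v)
    (hdiv : VectorCalculus.IsDivFree v) {R : ℝ} (hR : 0 < R) :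
    ∫ x in ball (0 : EuclideanSpace ℝ (Fin 3)) R, ⟪x, v x⟫ ^ 2 / ‖x‖ ^ 3 =
      (2 * R)⁻¹ * ∫ x in ball (0 : EuclideanSpace ℝ (Fin 3)) R, ‖v x‖ ^ 2 :=
  ChaeWolf2016.integral_normalSq_div_norm_eq hv hdiv (h.convect_eq_gradient_of_contDiff hv) hR

/-- **Chae–Wolf 2016, Theorem 1.3 (Liouville, annular form)** for the tree's Beltrami predicate.
[cite: ChaeWolf2016, Theorem 1.3 (2.13)] -/
theorem _root_.Literature.Analysis.FluidPDE.IsBeltrami.eq_zero_of_tangential_annulus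
    {lam : EuclideanSpace ℝ (Fin 3) → ℝ} (h : IsBeltrami v lam) (hv : ContDiff ℝ 1 v)
    (hdiv : VectorCalculus.IsDivFree v) (Rk : ℕ → ℝ) (hRpos : ∀ k, 0 < Rk k)
    (hRk : Tendsto Rk atTop atTop)
    (htan : Tendsto (fun k => (Rk k)⁻¹ * ∫ x in ball (0 : EuclideanSpace ℝ (Fin 3)) (2 * Rk k) \ ball (0 : EuclideanSpace ℝ (Fin 3)) (Rk k),
      (‖v x‖ ^ 2 - ⟪x, v x⟫ ^ 2 / ‖x‖ ^ 2)) atTop (𝓝 0)) :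
    v = 0 :=
  ChaeWolf2016.eq_zero_of_tangential_annulus hv hdiv (h.convect_eq_gradient_of_contDiff hv) Rk
    hRpos hRk htan

/-- **Nadirashvili 2014 (= Chae–Wolf Remark 1.4 (i) with `u` for `u_T`)**: a `C¹` divergence-free
Beltrami field with `|v(x)| = o(|x|⁻¹)`, i.e. `|x| |v(x)| → 0` as `|x| → ∞`, vanishes identically.
The decay threshold is sharp: Enciso–Peralta-Salas 2012 construct non-trivial Beltrami fields with
`|v| ≤ K/|x|` [`EncisoPeraltasalas2012`].
[cite: ChaeWolf2016, Remark 1.4 (i) and §1 p. 1 ([nad])][cite: Nadirashvili2014, Theorem] -/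
theorem _root_.Literature.Analysis.FluidPDE.IsBeltrami.eq_zero_of_norm_mul_norm_tendsto_zero
    {lam : EuclideanSpace ℝ (Fin 3) → ℝ} (h : IsBeltrami v lam) (hv : ContDiff ℝ 1 v)
    (hdiv : VectorCalculus.IsDivFree v)
    (hdec : Tendsto (fun x : EuclideanSpace ℝ (Fin 3) => ‖x‖ * ‖v x‖) (cocompact (EuclideanSpace ℝ (Fin 3))) (𝓝 0)) : v = 0 := by
  refine ChaeWolf2016.eq_zero_of_tangential_littleO hv hdiv (h.convect_eq_gradient_of_contDiff hv) ?_
  have h2 : Tendsto (fun x : EuclideanSpace ℝ (Fin 3) => (‖x‖ * ‖v x‖) ^ 2) (cocompact (EuclideanSpace ℝ (Fin 3))) (𝓝 0) := by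
    simpa using hdec.pow 2
  refine tendsto_of_tendsto_of_tendsto_of_le_of_le tendsto_const_nhds h2 (fun x => ?_) fun x => ?_
  · exact mul_nonneg (sq_nonneg _) (SereginSverak2002.tangential_nonneg (v x) x)
  · rw [mul_pow]
    exact mul_le_mul_of_nonneg_left (SereginSverak2002.tangential_le_norm_sq (v x) x) (sq_nonneg _)

/-- **Nadirashvili 2014 (= Chae–Wolf Remark 1.4 (ii) with `u` for `u_T`)**: a `C¹`
divergence-free Beltrami field with `v ∈ L^q(ℝ³)` for some `q ∈ [2,3]` (here: `|v|^q ∈ L¹`)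
vanishes identically.
[cite: ChaeWolf2016, Remark 1.4 (ii) and §1 p. 1 ([nad])][cite: Nadirashvili2014, Theorem] -/
theorem _root_.Literature.Analysis.FluidPDE.IsBeltrami.eq_zero_of_integrable_norm_rpow
    {lam : EuclideanSpace ℝ (Fin 3) → ℝ} (h : IsBeltrami v lam) (hv : ContDiff ℝ 1 v)
    (hdiv : VectorCalculus.IsDivFree v) {q : ℝ} (hq2 : 2 ≤ q) (hq3 : q ≤ 3)
    (hint : Integrable (fun x : EuclideanSpace ℝ (Fin 3) => ‖v x‖ ^ q)) : v = 0 := by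
  refine ChaeWolf2016.eq_zero_of_tangential_Lq hv hdiv (h.convect_eq_gradient_of_contDiff hv) hq2
    hq3 ?_
  refine hint.mono' ?_ (Eventually.of_forall fun x => ?_)
  · have hm : Measurable fun x : EuclideanSpace ℝ (Fin 3) => ‖v x‖ ^ 2 - ⟪x, v x⟫ ^ 2 / ‖x‖ ^ 2 :=
      (hv.continuous.norm.pow 2).measurable.sub (((continuous_id.inner hv.continuous).pow 2
        ).measurable.div ((continuous_norm.pow 2).measurable))
    exact (hm.pow_const _).aestronglyMeasurable
  · have hT := SereginSverak2002.tangential_nonneg (v x) x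
    rw [Real.norm_eq_abs, abs_of_nonneg (Real.rpow_nonneg hT _)]
    calc (‖v x‖ ^ 2 - ⟪x, v x⟫ ^ 2 / ‖x‖ ^ 2) ^ (q / 2) ≤ (‖v x‖ ^ 2) ^ (q / 2) :=
          Real.rpow_le_rpow hT (SereginSverak2002.tangential_le_norm_sq (v x) x) (by linarith)
      _ = ‖v x‖ ^ q := by
          rw [← Real.rpow_natCast, ← Real.rpow_mul (norm_nonneg _)]
          congr 1
          push_cast
          ring

/-- **Chae–Constantin 2015 (= Chae–Wolf Remark 1.4 (iii) with `u` for `u_T`)**: a `C¹`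
divergence-free Beltrami field with `|v|²/|x|^μ ∈ L¹(ℝ³)` for some `μ ≤ 1` vanishes identically.
[cite: ChaeWolf2016, Remark 1.4 (iii) and §1 p. 1 ([cha])][cite: ChaeConstantin2014, Theorem 1.1] -/
theorem _root_.Literature.Analysis.FluidPDE.IsBeltrami.eq_zero_of_integrable_norm_sq_div_rpow
    {lam : EuclideanSpace ℝ (Fin 3) → ℝ} (h : IsBeltrami v lam) (hv : ContDiff ℝ 1 v)
    (hdiv : VectorCalculus.IsDivFree v) {μ : ℝ} (hμ : μ ≤ 1)
    (hint : Integrable (fun x : EuclideanSpace ℝ (Fin 3) => ‖v x‖ ^ 2 / ‖x‖ ^ μ)) : v = 0 := by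
  refine ChaeWolf2016.eq_zero_of_tangential_weighted hv hdiv (h.convect_eq_gradient_of_contDiff hv)
    hμ ?_
  refine hint.mono' ?_ (Eventually.of_forall fun x => ?_)
  · have hm : Measurable fun x : EuclideanSpace ℝ (Fin 3) => ‖v x‖ ^ 2 - ⟪x, v x⟫ ^ 2 / ‖x‖ ^ 2 :=
      (hv.continuous.norm.pow 2).measurable.sub (((continuous_id.inner hv.continuous).pow 2
        ).measurable.div ((continuous_norm.pow 2).measurable))
    exact (hm.div (continuous_norm.measurable.pow_const _)).aestronglyMeasurable
  · have hT := SereginSverak2002.tangential_nonneg (v x) x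
    have hxμ : 0 ≤ ‖x‖ ^ μ := Real.rpow_nonneg (norm_nonneg _) _
    rw [Real.norm_eq_abs, abs_of_nonneg (div_nonneg hT hxμ)]
    exact div_le_div_of_nonneg_right (SereginSverak2002.tangential_le_norm_sq (v x) x) hxμ


/-! ### The sphere form: (2.11) as printed and Theorem 1.3 under the printed hypothesis (2.13)

With the tree's `sphereIntegral volume f r = ∫ f(rα) dσ(α)` (`σ = volume.toSphere`, the surface
measure on the unit sphere of `ℝ³`; `Literature/Analysis/FluidPDE/SphereIntegral.lean`) the surface
integral over the sphere of radius `R` is `∫_{∂B_R} f dS = R² · sphereIntegral volume f R`. -/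

/-- The ball and the punctured ball agree up to a null set. [folklore] -/
private theorem ball_ae_eq_shell (R : ℝ) :
    (ball (0 : EuclideanSpace ℝ (Fin 3)) R : Set (EuclideanSpace ℝ (Fin 3))) =ᵐ[volume]
      {x : EuclideanSpace ℝ (Fin 3) | 0 < ‖x‖ ∧ ‖x‖ < R} := by
  refine ae_eq_set.2 ⟨?_, ?_⟩
  · refine measure_mono_null (fun x hx => ?_) (measure_singleton (0 : EuclideanSpace ℝ (Fin 3)))
    have h1 : ‖x‖ < R := mem_ball_zero_iff.1 hx.1
    have h2 : ¬ (0 < ‖x‖ ∧ ‖x‖ < R) := hx.2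
    have h3 : ‖x‖ ≤ 0 := by
      by_contra h
      exact h2 ⟨lt_of_not_ge h, h1⟩
    exact mem_singleton_iff.2 (norm_le_zero_iff.1 h3)
  · have : {x : EuclideanSpace ℝ (Fin 3) | 0 < ‖x‖ ∧ ‖x‖ < R} \ ball 0 R = ∅ := by
      ext x
      constructor
      · rintro ⟨hx, hx'⟩
        exact (hx' (mem_ball_zero_iff.2 hx.2)).elim
      · intro hx
        exact (Set.notMem_empty x hx).elim
    rw [this]; exact measure_empty

/-- **Polar coordinates on balls of `ℝ³`**: `∫_{B_R} f = ∫_{0<r<R} r² (∫ f(rα) dσ(α)) dr` for `f`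
integrable on the ball. [folklore] -/
private theorem setIntegral_ball_eq_radial {f : EuclideanSpace ℝ (Fin 3) → ℝ} {R : ℝ}
    (hf : IntegrableOn f (ball (0 : EuclideanSpace ℝ (Fin 3)) R)) :
    ∫ x in ball (0 : EuclideanSpace ℝ (Fin 3)) R, f x =
      ∫ r in Ioo 0 R, r ^ 2 * sphereIntegral volume f r := by
  haveI : Nontrivial (EuclideanSpace ℝ (Fin 3)) :=
    Module.nontrivial_of_finrank_pos (R := ℝ) (by rw [finrank_euclideanSpace_fin]; norm_num)
  have hsub : {x : EuclideanSpace ℝ (Fin 3) | 0 < ‖x‖ ∧ ‖x‖ < R} ⊆ ball 0 R :=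
    fun x hx => mem_ball_zero_iff.2 hx.2
  rw [setIntegral_congr_set (ball_ae_eq_shell R),
    setIntegral_shell_eq_integral_sphereIntegral volume (hf.mono_set hsub) le_rfl,
    finrank_euclideanSpace_fin]
  simp [smul_eq_mul]

/-- The radial part integrated over the unit sphere, `P(r) = ∫ ⟪α, v(rα)⟫² dσ(α)` (so that
`∫_{∂B_r}|v_N|² dS = r² P(r)`), is continuous in `r` for continuous `v`. [folklore] -/
private theorem continuous_radialSphere (hv : Continuous v) :
    Continuous fun r : ℝ => ∫ α : sphere (0 : EuclideanSpace ℝ (Fin 3)) 1,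
      ⟪(α : EuclideanSpace ℝ (Fin 3)), v (r • (α : EuclideanSpace ℝ (Fin 3)))⟫ ^ 2
        ∂(volume : Measure (EuclideanSpace ℝ (Fin 3))).toSphere := by
  have hF : Continuous (Function.uncurry fun (r : ℝ) (α : sphere (0 : EuclideanSpace ℝ (Fin 3)) 1) =>
      ⟪(α : EuclideanSpace ℝ (Fin 3)), v (r • (α : EuclideanSpace ℝ (Fin 3)))⟫ ^ 2) :=
    ((continuous_subtype_val.comp continuous_snd).inner
      (hv.comp (continuous_fst.smul (continuous_subtype_val.comp continuous_snd)))).pow 2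
  have h := continuous_parametric_integral_of_continuous
    (μ := (volume : Measure (EuclideanSpace ℝ (Fin 3))).toSphere) hF isCompact_univ
  simp only [Measure.restrict_univ] at h
  exact h

/-- At radius `r > 0`: `r² · sphereIntegral(⟪x,v⟫²/|x|³)(r) = r · P(r)`. [folklore] -/
private theorem sq_mul_sphereIntegral_normalSq_div (v : EuclideanSpace ℝ (Fin 3) → EuclideanSpace ℝ (Fin 3))
    {r : ℝ} (hr : 0 < r) :
    r ^ 2 * sphereIntegral volume (fun x : EuclideanSpace ℝ (Fin 3) => ⟪x, v x⟫ ^ 2 / ‖x‖ ^ 3) r =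
      r * ∫ α : sphere (0 : EuclideanSpace ℝ (Fin 3)) 1,
        ⟪(α : EuclideanSpace ℝ (Fin 3)), v (r • (α : EuclideanSpace ℝ (Fin 3)))⟫ ^ 2
          ∂(volume : Measure (EuclideanSpace ℝ (Fin 3))).toSphere := by
  rw [sphereIntegral_def, ← integral_const_mul, ← integral_const_mul]
  refine integral_congr_ae (Eventually.of_forall fun α => ?_)
  dsimp only
  rw [norm_smul_sphere hr.le α, inner_smul_left]
  simp only [RCLike.conj_to_real]
  field_simp

/-- At radius `r > 0`: `sphereIntegral(|v|² - c⟪x,v⟫²/|x|²)(r) = ∫‖v(rα)‖² dσ - c ∫⟪α,v(rα)⟫² dσ`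
(`c = 1`: the tangential energy `|v_T|²`; `c = 2`: `|v_T|² - |v_N|²`). [folklore] -/
private theorem sphereIntegral_sub_mul_normalSq (hv : Continuous v) (c : ℝ) {r : ℝ} (hr : 0 < r) :
    sphereIntegral volume (fun x : EuclideanSpace ℝ (Fin 3) => ‖v x‖ ^ 2 - c * (⟪x, v x⟫ ^ 2 / ‖x‖ ^ 2)) r =
      sphereIntegral volume (fun x : EuclideanSpace ℝ (Fin 3) => ‖v x‖ ^ 2) r -
        c * ∫ α : sphere (0 : EuclideanSpace ℝ (Fin 3)) 1,
          ⟪(α : EuclideanSpace ℝ (Fin 3)), v (r • (α : EuclideanSpace ℝ (Fin 3)))⟫ ^ 2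
            ∂(volume : Measure (EuclideanSpace ℝ (Fin 3))).toSphere := by
  rw [sphereIntegral_def, sphereIntegral_def]
  have hc0 : Continuous fun α : sphere (0 : EuclideanSpace ℝ (Fin 3)) 1 =>
      v (r • (α : EuclideanSpace ℝ (Fin 3))) :=
    hv.comp ((continuous_const (y := r)).smul continuous_subtype_val)
  have hc1 : Continuous fun α : sphere (0 : EuclideanSpace ℝ (Fin 3)) 1 =>
      ‖v (r • (α : EuclideanSpace ℝ (Fin 3)))‖ ^ 2 := hc0.norm.pow 2
  have hc2 : Continuous fun α : sphere (0 : EuclideanSpace ℝ (Fin 3)) 1 =>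
      ⟪(α : EuclideanSpace ℝ (Fin 3)), v (r • (α : EuclideanSpace ℝ (Fin 3)))⟫ ^ 2 :=
    (continuous_subtype_val.inner hc0).pow 2
  have hK1 : HasCompactSupport fun α : sphere (0 : EuclideanSpace ℝ (Fin 3)) 1 =>
      ‖v (r • (α : EuclideanSpace ℝ (Fin 3)))‖ ^ 2 := HasCompactSupport.of_compactSpace _
  have hK2 : HasCompactSupport fun α : sphere (0 : EuclideanSpace ℝ (Fin 3)) 1 =>
      ⟪(α : EuclideanSpace ℝ (Fin 3)), v (r • (α : EuclideanSpace ℝ (Fin 3)))⟫ ^ 2 :=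
    HasCompactSupport.of_compactSpace _
  have hI1 := hc1.integrable_of_hasCompactSupport
    (μ := (volume : Measure (EuclideanSpace ℝ (Fin 3))).toSphere) hK1
  have hI2 := hc2.integrable_of_hasCompactSupport
    (μ := (volume : Measure (EuclideanSpace ℝ (Fin 3))).toSphere) hK2
  rw [← integral_const_mul, ← integral_sub hI1 (hI2.const_mul c)]
  refine integral_congr_ae (Eventually.of_forall fun α => ?_)
  dsimp only
  rw [norm_smul_sphere hr.le α, inner_smul_left]
  simp only [RCLike.conj_to_real]
  field_simp

/-- **Chae–Wolf 2016, (2.11) as printed** (classical Beltrami flows): for every `R > 0`,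
`R⁻¹ ∫_{B_R} |v|² = ∫_{∂B_R} (|v_T|² - |v_N|²) dS`, the right-hand side being
`R² · sphereIntegral volume (|v|² - 2⟪x,v⟫²/|x|²) R`
(`|v_T|² - |v_N|² = |v|² - 2⟪x,v⟫²/|x|²`).  Obtained from (2.12) in polar coordinates by
differentiating in `R` (fundamental theorem of calculus for the continuous radial densities).
[cite: ChaeWolf2016, (2.11)] -/
theorem energyRatio_eq_sphereIntegral (hv : ContDiff ℝ 1 v) (hdiv : VectorCalculus.IsDivFree v)
    (hconv : ∀ x, convect v v x = gradient (fun y => ‖v y‖ ^ 2 / 2) x) {R : ℝ} (hR : 0 < R) :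
    R⁻¹ * ∫ x in ball (0 : EuclideanSpace ℝ (Fin 3)) R, ‖v x‖ ^ 2 =
      R ^ 2 * sphereIntegral volume
        (fun x : EuclideanSpace ℝ (Fin 3) => ‖v x‖ ^ 2 - 2 * (⟪x, v x⟫ ^ 2 / ‖x‖ ^ 2)) R := by
  have hvc := hv.continuous
  -- the radial densities `S` and `P`
  set S : ℝ → ℝ := fun r => sphereIntegral volume (fun x : EuclideanSpace ℝ (Fin 3) => ‖v x‖ ^ 2) r
    with hS
  set P : ℝ → ℝ := fun r => ∫ α : sphere (0 : EuclideanSpace ℝ (Fin 3)) 1,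
      ⟪(α : EuclideanSpace ℝ (Fin 3)), v (r • (α : EuclideanSpace ℝ (Fin 3)))⟫ ^ 2
        ∂(volume : Measure (EuclideanSpace ℝ (Fin 3))).toSphere with hP
  have hSc : Continuous S := continuous_sphereIntegral volume (hvc.norm.pow 2)
  have hPc : Continuous P := continuous_radialSphere hvc
  -- the ball integral of `|v|²` in polar coordinates
  have hball : ∀ ρ : ℝ, 0 < ρ →
      ∫ x in ball (0 : EuclideanSpace ℝ (Fin 3)) ρ, ‖v x‖ ^ 2 = ∫ r in 0..ρ, r ^ 2 * S r := by
    intro ρ hρ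
    rw [setIntegral_ball_eq_radial (f := fun x => ‖v x‖ ^ 2)
        (((hvc.norm.pow 2).continuousOn.integrableOn_compact
        (isCompact_closedBall (0 : EuclideanSpace ℝ (Fin 3)) ρ)).mono_set ball_subset_closedBall),
      intervalIntegral.integral_of_le hρ.le,
      ← setIntegral_congr_set (Ioo_ae_eq_Ioc (μ := volume) (a := (0 : ℝ)) (b := ρ))]
  -- (2.12) in polar coordinates: `∫_0^ρ r P(r) dr = 2⁻¹ (ρ⁻¹ ∫_0^ρ r² S(r) dr)` for every `ρ > 0`
  have hrad : ∀ ρ : ℝ, 0 < ρ →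
      ∫ r in 0..ρ, r * P r = 2⁻¹ * (ρ⁻¹ * ∫ r in 0..ρ, r ^ 2 * S r) := by
    intro ρ hρ
    have hA := integral_normalSq_div_norm_eq hv hdiv hconv hρ
    rw [hball ρ hρ, setIntegral_ball_eq_radial (integrableOn_normalSq_div_ball hvc ρ),
      mul_inv, mul_assoc] at hA
    rw [← hA, intervalIntegral.integral_of_le hρ.le,
      ← setIntegral_congr_set (Ioo_ae_eq_Ioc (μ := volume) (a := (0 : ℝ)) (b := ρ))]
    refine setIntegral_congr_fun measurableSet_Ioo fun r hr => ?_
    exact (sq_mul_sphereIntegral_normalSq_div v hr.1).symm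
  -- differentiate both sides at `R`
  have hL : HasDerivAt (fun ρ => ∫ r in 0..ρ, r * P r) (R * P R) R :=
    ((continuous_id.mul hPc).integral_hasStrictDerivAt 0 R).hasDerivAt
  have hF : HasDerivAt (fun ρ => ∫ r in 0..ρ, r ^ 2 * S r) (R ^ 2 * S R) R :=
    (((continuous_id.pow 2).mul hSc).integral_hasStrictDerivAt 0 R).hasDerivAt
  have hG : HasDerivAt (fun ρ : ℝ => 2⁻¹ * (ρ⁻¹ * ∫ r in 0..ρ, r ^ 2 * S r))
      (2⁻¹ * (-(R ^ 2)⁻¹ * (∫ r in 0..R, r ^ 2 * S r) + R⁻¹ * (R ^ 2 * S R))) R :=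
    ((hasDerivAt_inv hR.ne').mul hF).const_mul _
  have heq : (fun ρ : ℝ => 2⁻¹ * (ρ⁻¹ * ∫ r in 0..ρ, r ^ 2 * S r)) =ᶠ[𝓝 R]
      fun ρ => ∫ r in 0..ρ, r * P r := by
    filter_upwards [Ioi_mem_nhds hR] with ρ hρ
    exact (hrad ρ hρ).symm
  have hG' : HasDerivAt (fun ρ : ℝ => 2⁻¹ * (ρ⁻¹ * ∫ r in 0..ρ, r ^ 2 * S r)) (R * P R) R :=
    hL.congr_of_eventuallyEq heq
  have huniq := hG.unique hG'
  -- assemble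
  rw [hball R hR, sphereIntegral_sub_mul_normalSq hvc 2 hR]
  have hSR : sphereIntegral volume (fun x : EuclideanSpace ℝ (Fin 3) => ‖v x‖ ^ 2) R = S R := rfl
  rw [hSR]
  have hR0 : R ≠ 0 := hR.ne'
  field_simp at huniq
  have key : ∫ r in 0..R, r ^ 2 * S r = R ^ 3 * S R - 2 * R ^ 3 * P R := by
    linear_combination -huniq
  rw [key]
  field_simp
  ring

/-- `∫_{∂B_R}(|v_T|² - |v_N|²) dS ≤ ∫_{∂B_R}|v_T|² dS`, i.e. with (2.11):
`R⁻¹ ∫_{B_R}|v|² ≤ R² · sphereIntegral volume |v_T|² R`. [cite: ChaeWolf2016, proof of Theorem 1.3 in §2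
(«φ(R) ≤ ∫_{∂B_R}|u_T|² dS»)] -/
theorem energyRatio_le_sphereIntegral_tangential (hv : ContDiff ℝ 1 v)
    (hdiv : VectorCalculus.IsDivFree v)
    (hconv : ∀ x, convect v v x = gradient (fun y => ‖v y‖ ^ 2 / 2) x) {R : ℝ} (hR : 0 < R) :
    R⁻¹ * ∫ x in ball (0 : EuclideanSpace ℝ (Fin 3)) R, ‖v x‖ ^ 2 ≤
      R ^ 2 * sphereIntegral volume
        (fun x : EuclideanSpace ℝ (Fin 3) => ‖v x‖ ^ 2 - ⟪x, v x⟫ ^ 2 / ‖x‖ ^ 2) R := by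
  have hvc := hv.continuous
  rw [energyRatio_eq_sphereIntegral hv hdiv hconv hR, sphereIntegral_sub_mul_normalSq hvc 2 hR]
  have h1 := sphereIntegral_sub_mul_normalSq hvc 1 hR
  simp only [one_mul] at h1
  rw [h1]
  have hP : 0 ≤ ∫ α : sphere (0 : EuclideanSpace ℝ (Fin 3)) 1,
      ⟪(α : EuclideanSpace ℝ (Fin 3)), v (R • (α : EuclideanSpace ℝ (Fin 3)))⟫ ^ 2
        ∂(volume : Measure (EuclideanSpace ℝ (Fin 3))).toSphere :=
    integral_nonneg fun α => sq_nonneg _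
  nlinarith [sq_nonneg R]

/-- **Chae–Wolf 2016, Theorem 1.3 (Liouville part) with the PRINTED hypothesis (2.13)**: let
`v ∈ C¹(ℝ³;ℝ³)` be divergence free with `(v·∇)v = ∇(½|v|²)` (a classical Beltrami flow). If there
is a sequence `R_k → +∞` with `∫_{∂B_{R_k}} |v_T|² dS → 0`, i.e.
`R_k² · sphereIntegral volume (|v|² - ⟪x,v⟫²/|x|²) R_k → 0`, then `v ≡ 0`.
[cite: ChaeWolf2016, Theorem 1.3 (2.13)] -/
theorem eq_zero_of_tangential_spheres (hv : ContDiff ℝ 1 v) (hdiv : VectorCalculus.IsDivFree v)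
    (hconv : ∀ x, convect v v x = gradient (fun y => ‖v y‖ ^ 2 / 2) x)
    (Rk : ℕ → ℝ) (hRpos : ∀ k, 0 < Rk k) (hRk : Tendsto Rk atTop atTop)
    (hsph : Tendsto (fun k => Rk k ^ 2 * sphereIntegral volume
      (fun x : EuclideanSpace ℝ (Fin 3) => ‖v x‖ ^ 2 - ⟪x, v x⟫ ^ 2 / ‖x‖ ^ 2) (Rk k))
      atTop (𝓝 0)) :
    v = 0 := by
  refine eq_zero_of_integral_ball_eq_zero hv.continuous fun ρ hρ => ?_
  have hle : ρ⁻¹ * ∫ x in ball (0 : EuclideanSpace ℝ (Fin 3)) ρ, ‖v x‖ ^ 2 ≤ 0 := by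
    refine ge_of_tendsto hsph ?_
    filter_upwards [hRk.eventually_ge_atTop ρ] with k hk
    exact (energyRatio_mono hv hdiv hconv hρ hk).trans
      (energyRatio_le_sphereIntegral_tangential hv hdiv hconv (hRpos k))
  have hge : 0 ≤ ∫ x in ball (0 : EuclideanSpace ℝ (Fin 3)) ρ, ‖v x‖ ^ 2 :=
    integral_nonneg fun x => by positivity
  have h1 : ρ⁻¹ * ∫ x in ball (0 : EuclideanSpace ℝ (Fin 3)) ρ, ‖v x‖ ^ 2 ≤ ρ⁻¹ * 0 := by
    rw [mul_zero]; exact hle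
  have := le_of_mul_le_mul_left h1 (inv_pos.2 hρ)
  linarith

/-- **Chae–Wolf 2016, Theorem 1.3 with the printed sphere hypothesis (2.13)**, for the tree's
`IsBeltrami` predicate. [cite: ChaeWolf2016, Theorem 1.3 (2.13)] -/
theorem _root_.Literature.Analysis.FluidPDE.IsBeltrami.eq_zero_of_tangential_spheres
    {lam : EuclideanSpace ℝ (Fin 3) → ℝ} (h : IsBeltrami v lam) (hv : ContDiff ℝ 1 v)
    (hdiv : VectorCalculus.IsDivFree v) (Rk : ℕ → ℝ) (hRpos : ∀ k, 0 < Rk k)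
    (hRk : Tendsto Rk atTop atTop)
    (hsph : Tendsto (fun k => Rk k ^ 2 * sphereIntegral volume
      (fun x : EuclideanSpace ℝ (Fin 3) => ‖v x‖ ^ 2 - ⟪x, v x⟫ ^ 2 / ‖x‖ ^ 2) (Rk k))
      atTop (𝓝 0)) :
    v = 0 :=
  ChaeWolf2016.eq_zero_of_tangential_spheres hv hdiv (h.convect_eq_gradient_of_contDiff hv) Rk
    hRpos hRk hsph

end ChaeWolf2016

end Literature.Analysis.FluidPDE
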